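import Mathlib
import Literature.Analysis.FluidPDE.ChoiEtAl2017PeriodicHouLuoLemma7Kernel
import Literature.Analysis.FluidPDE.ChoiEtAl2017PeriodicHouLuoFunctional
import Literature.Analysis.FluidPDE.ChoiEtAl2017PeriodicHouLuoAssembly
import HarnessLib

/-!
# Choi–Hou–Kiselev–Luo–Šverák–Yao 2017, §4 Lemma 7 (the sign of `∫ₐ^{L/2} ω (u cot(μx))_x dx`)

HONEST FRAMING (cell ns-blowup GROUP B «PROFILE SEARCH», zones Z3-b′ / Z8 = the Hou–Luo boundary
MODEL): **1-D MODEL (Hou–Luo), not Euler/NS.** Source: K. Choi, T. Y. Hou, A. Kiselev, G. Luo,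
V. Šverák, Y. Yao, Comm. Pure Appl. Math. **70** (2017) 2218–2243 = arXiv:1407.4776
[ChoiHouKiselevLuoSverakYao2017], §4 Lemma 7, p. 12: for smooth odd `L`-periodic `ω ≥ 0` on
`[0, ½L]`, `u = Qω`, and every `a ∈ [0, ½L]`, `∫ₐ^{L/2} ω(x) (u(x) cot(μx))_x dx ≥ 0`.

PROOF FOLLOWED (printed proof, p. 12, made rigorous where the print manipulates a principal value):
integrate by parts in `x` (the print's first step), insert Lemma 6 (`u cot(μx) = −(1/π)∫ K ωcot`,
`ChoiEtAl2017PeriodicHouLuoKernel`), so that `π ∫ₐ^{L/2} ω (u cot)_x = ω(a)Φ(a) + ∫ₐ^{L/2} ω′Φ`,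
`Φ(x) = ∫₀^{L/2} K(x,y)ω(y)cot(μy)dy`, an absolutely convergent double integral (Tonelli). The
print's `I₂ = −(1/π)∫∫ ω(x)ω(y)cot(μy)G(x,y) = (1/2π)∫∫ ωωT ≥ 0` (`G = K_x`, `T ≤ 0`) is a
principal value; here the band `(1+δ)⁻¹ < s < 1+δ` of `s = tan(μy)/tan(μx)` is excised — a region
symmetric under `(x,y) ↦ (y,x)` on whose two edges `K` is CONSTANT (`φ(1+δ)`, `φ(1+δ)/(1+δ)²`,
`ChoiEtAl2017PeriodicHouLuoLemma7Kernel`) — the `x`-integration by parts is done per `y` off the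
band, the swap-symmetric part is `½∫∫ ω(x)ω(y)T ≤ 0` exactly as printed, the part `y < a ≤ x` has
`G ≤ 0` pointwise, and the band integral and the boundary terms (`O(δ log δ⁻¹)`) vanish as `δ → 0`.

## What is proved (no definitions, no named facts; net debt 0)

* `ChoiEtAl2017.lemma7` — Lemma 7 in the `h7`-shape consumed by
  `not_isGlobalSmooth_of_unique_of_lemma7` (`ChoiEtAl2017PeriodicHouLuoReflection`).

WHAT THIS IS NOT: not Euler, not Navier–Stokes; a lemma about the 1-D periodic wall MODEL.
`violates:` none — MODEL.
-/

noncomputable section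

open Set Filter Real MeasureTheory intervalIntegral
open _root_.Topology

namespace Literature.Analysis.FluidPDE

namespace ChoiEtAl2017

/-! ### §1 Phases and the truncation points `x∓(y) = (L/π)·arctan((1+δ)^{∓1} tan(μy))` -/

/-- `μx ∈ (0, π/2)` for `x ∈ (0, ½L)`. [folklore] -/
private theorem phase_Ioo₇ {L x : ℝ} (hL : 0 < L) (hx : x ∈ Ioo 0 (L / 2)) :
    π * x / L ∈ Ioo 0 (π / 2) :=
  ⟨div_pos (mul_pos Real.pi_pos hx.1) hL, by rw [div_lt_iff₀ hL]; nlinarith [hx.2, Real.pi_pos]⟩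

/-- `cot(μy) ≥ 0` for `y ∈ [0, ½L]`. [folklore] -/
private theorem cot_phase_nonneg₇ {L y : ℝ} (hL : 0 < L) (hy : y ∈ Icc 0 (L / 2)) :
    0 ≤ Real.cot (π * y / L) := by
  rw [Real.cot_eq_cos_div_sin]
  have h0 : 0 ≤ π * y / L := div_nonneg (mul_nonneg Real.pi_pos.le hy.1) hL.le
  have h1 : π * y / L ≤ π / 2 := by rw [div_le_iff₀ hL]; nlinarith [hy.2, Real.pi_pos]
  exact div_nonneg (Real.cos_nonneg_of_mem_Icc ⟨by linarith [Real.pi_pos], h1⟩)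
    (Real.sin_nonneg_of_nonneg_of_le_pi h0 (by linarith [Real.pi_pos]))

/-- `ω(y)cot(μy) ≥ 0` on `[0, ½L]` when `ω ≥ 0` there. [folklore] -/
private theorem mul_cot_nonneg₇ {L y : ℝ} (hL : 0 < L) {w : ℝ → ℝ} (hnn : ∀ y ∈ Icc 0 (L / 2), 0 ≤ w y)
    (hy : y ∈ Icc 0 (L / 2)) : 0 ≤ w y * Real.cot (π * y / L) :=
  mul_nonneg (hnn y hy) (cot_phase_nonneg₇ hL hy)

/-- An odd `L`-periodic function vanishes at `0` and at `½L`. [folklore] -/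
private theorem odd_periodic_zero_half {L : ℝ} {w : ℝ → ℝ} (hodd : ∀ y, w (-y) = -w y)
    (hper : Function.Periodic w L) : w 0 = 0 ∧ w (L / 2) = 0 := by
  have h0 : w 0 = 0 := by have h := hodd 0; rw [neg_zero] at h; linarith
  refine ⟨h0, ?_⟩
  have h1 : w (L / 2) = w (-(L / 2)) := by
    have := hper (-(L / 2)); rw [show -(L / 2) + L = L / 2 by ring] at this; exact this
  rw [hodd] at h1
  linarith

/-- The phase of the point `(L/π)·arctan z` is `arctan z`. [folklore] -/
private theorem phase_arctan {L : ℝ} (hL : 0 < L) (z : ℝ) :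
    π * (L / π * Real.arctan z) / L = Real.arctan z := by
  field_simp

/-- `tan` of the phase of `(L/π)·arctan z` is `z`. [folklore] -/
private theorem tan_phase_arctan {L : ℝ} (hL : 0 < L) (z : ℝ) :
    Real.tan (π * (L / π * Real.arctan z) / L) = z := by
  rw [phase_arctan hL, Real.tan_arctan]

/-- `(L/π)·arctan z ∈ (0, ½L)` for `z > 0`. [folklore] -/
private theorem arctan_pt_mem_Ioo {L z : ℝ} (hL : 0 < L) (hz : 0 < z) :
    L / π * Real.arctan z ∈ Ioo 0 (L / 2) := by
  have h1 : 0 < Real.arctan z := Real.arctan_pos.2 hz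
  have h2 : Real.arctan z < π / 2 := Real.arctan_lt_pi_div_two z
  refine ⟨by positivity, ?_⟩
  calc L / π * Real.arctan z < L / π * (π / 2) := mul_lt_mul_of_pos_left h2 (by positivity)
    _ = L / 2 := by field_simp

/-- For `x, c ∈ (0, ½L)`: `tan(μx) < tan(μc) ↔ x < c`. [folklore] -/
private theorem tan_phase_lt_iff {L x c : ℝ} (hL : 0 < L) (hx : x ∈ Ioo 0 (L / 2))
    (hc : c ∈ Ioo 0 (L / 2)) : Real.tan (π * x / L) < Real.tan (π * c / L) ↔ x < c := by
  have hpx := phase_Ioo₇ hL hx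
  have hpc := phase_Ioo₇ hL hc
  rw [Real.strictMonoOn_tan.lt_iff_lt ⟨by linarith [hpx.1, Real.pi_pos], hpx.2⟩
    ⟨by linarith [hpc.1, Real.pi_pos], hpc.2⟩]
  constructor
  · intro h
    have h' := (div_lt_div_iff_of_pos_right hL).1 h
    nlinarith [Real.pi_pos]
  · intro h
    exact div_lt_div_of_pos_right (mul_lt_mul_of_pos_left h Real.pi_pos) hL

/-- For `x, c ∈ (0, ½L)`: `tan(μx) ≤ tan(μc) ↔ x ≤ c`. [folklore] -/
private theorem tan_phase_le_iff {L x c : ℝ} (hL : 0 < L) (hx : x ∈ Ioo 0 (L / 2))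
    (hc : c ∈ Ioo 0 (L / 2)) : Real.tan (π * x / L) ≤ Real.tan (π * c / L) ↔ x ≤ c := by
  rw [← not_lt, tan_phase_lt_iff hL hc hx, not_lt]

/-- `tan(μ·)` is injective on `(0, ½L)`. [folklore] -/
private theorem tan_phase_inj {L x c : ℝ} (hL : 0 < L) (hx : x ∈ Ioo 0 (L / 2))
    (hc : c ∈ Ioo 0 (L / 2)) (h : Real.tan (π * x / L) = Real.tan (π * c / L)) : x = c :=
  le_antisymm ((tan_phase_le_iff hL hx hc).1 h.le) ((tan_phase_le_iff hL hc hx).1 h.ge)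

/-- **The truncation points.** For `y ∈ (0, ½L)` and `λ > 1`, the points
`x₋(y) = (L/π)arctan(tan(μy)/λ)` and `x₊(y) = (L/π)arctan(λ tan(μy))` lie in `(0, ½L)`, have
`tan(μx₋) = tan(μy)/λ`, `tan(μx₊) = λ tan(μy)`, and `x₋(y) < y < x₊(y)` — the two edges of the
excised band `λ⁻¹ < s < λ` of the symmetrised principal value.
[cite: ChoiHouKiselevLuoSverakYao2017, §4 proof of Lemma 7, p. 12 (the symmetrisation I₂ = (1/2π)∫∫ωωT)] -/
theorem cut_points {L lam y : ℝ} (hL : 0 < L) (hlam : 1 < lam) (hy : y ∈ Ioo 0 (L / 2)) :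
    (L / π * Real.arctan (Real.tan (π * y / L) / lam) ∈ Ioo 0 (L / 2) ∧
      Real.tan (π * (L / π * Real.arctan (Real.tan (π * y / L) / lam)) / L) =
        Real.tan (π * y / L) / lam ∧
      L / π * Real.arctan (Real.tan (π * y / L) / lam) < y) ∧
    (L / π * Real.arctan (lam * Real.tan (π * y / L)) ∈ Ioo 0 (L / 2) ∧
      Real.tan (π * (L / π * Real.arctan (lam * Real.tan (π * y / L))) / L) =
        lam * Real.tan (π * y / L) ∧
      y < L / π * Real.arctan (lam * Real.tan (π * y / L))) := by
  have ht := tan_phase_pos_of_mem_Ioo hL hy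
  have hlam0 : 0 < lam := by linarith
  have hm := arctan_pt_mem_Ioo hL (div_pos ht hlam0)
  have hp := arctan_pt_mem_Ioo hL (mul_pos hlam0 ht)
  refine ⟨⟨hm, tan_phase_arctan hL _, ?_⟩, ⟨hp, tan_phase_arctan hL _, ?_⟩⟩
  · apply (tan_phase_lt_iff hL hm hy).1
    rw [tan_phase_arctan hL]
    exact div_lt_self ht hlam
  · apply (tan_phase_lt_iff hL hy hp).1
    rw [tan_phase_arctan hL]
    exact lt_mul_of_one_lt_left ht hlam

/-- **Membership in the band in terms of the truncation points**: for `x, y ∈ (0, ½L)`,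
`tan(μx) < λ tan(μy) ∧ tan(μy) < λ tan(μx)` iff `x₋(y) < x < x₊(y)`.
[cite: ChoiHouKiselevLuoSverakYao2017, §4 proof of Lemma 7, p. 12 (the symmetrisation I₂ = (1/2π)∫∫ωωT)] -/
theorem band_iff_cuts {L lam x y : ℝ} (hL : 0 < L) (hlam : 1 < lam) (hx : x ∈ Ioo 0 (L / 2))
    (hy : y ∈ Ioo 0 (L / 2)) :
    (Real.tan (π * x / L) < lam * Real.tan (π * y / L) ∧
        Real.tan (π * y / L) < lam * Real.tan (π * x / L)) ↔
      (L / π * Real.arctan (Real.tan (π * y / L) / lam) < x ∧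
        x < L / π * Real.arctan (lam * Real.tan (π * y / L))) := by
  obtain ⟨⟨hm, htm, -⟩, ⟨hp, htp, -⟩⟩ := cut_points hL hlam hy
  have hlam0 : 0 < lam := by linarith
  constructor
  · rintro ⟨h1, h2⟩
    refine ⟨(tan_phase_lt_iff hL hm hx).1 ?_, (tan_phase_lt_iff hL hx hp).1 ?_⟩
    · rw [htm, div_lt_iff₀ hlam0]
      linarith
    · rw [htp]
      exact h1
  · rintro ⟨h1, h2⟩
    have h1' := (tan_phase_lt_iff hL hm hx).2 h1
    have h2' := (tan_phase_lt_iff hL hx hp).2 h2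
    rw [htm, div_lt_iff₀ hlam0] at h1'
    rw [htp] at h2'
    exact ⟨h2', by linarith⟩

/-! ### §2 Measurability of the kernel data -/

/-- `x ↦ tan(μx)` is measurable (`tan = sin/cos`). [folklore] -/
private theorem measurable_tan_phase (L : ℝ) : Measurable fun x : ℝ => Real.tan (π * x / L) := by
  have h : (fun x : ℝ => Real.tan (π * x / L)) =
      fun x => Real.sin (π * x / L) / Real.cos (π * x / L) :=
    funext fun x => Real.tan_eq_sin_div_cos _
  rw [h]
  fun_prop

/-- `x ↦ cot(μx)` is measurable (`cot = cos/sin`). [folklore] -/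
private theorem measurable_cot_phase (L : ℝ) : Measurable fun x : ℝ => Real.cot (π * x / L) := by
  have h : (fun x : ℝ => Real.cot (π * x / L)) =
      fun x => Real.cos (π * x / L) / Real.sin (π * x / L) :=
    funext fun x => Real.cot_eq_cos_div_sin _
  rw [h]
  fun_prop

/-- `φ` is measurable. [folklore] -/
private theorem measurable_hlKernelFn : Measurable hlKernelFn := by
  unfold hlKernelFn
  fun_prop

/-- `φ′` is measurable. [folklore] -/
private theorem measurable_hlKernelFnDeriv : Measurable hlKernelFnDeriv := by
  unfold hlKernelFnDeriv
  fun_prop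

/-- `(x,y) ↦ s(x,y)` is measurable. [folklore] -/
private theorem measurable_hlRatio₂ (L : ℝ) : Measurable fun p : ℝ × ℝ => hlRatio L p.1 p.2 := by
  unfold hlRatio
  exact ((measurable_tan_phase L).comp measurable_snd).div
    ((measurable_tan_phase L).comp measurable_fst)

/-- `(x,y) ↦ K(x,y)` is measurable. [folklore] -/
private theorem measurable_hlKernel₂ (L : ℝ) : Measurable fun p : ℝ × ℝ => hlKernel L p.1 p.2 := by
  unfold hlKernel
  exact measurable_hlKernelFn.comp (measurable_hlRatio₂ L)

/-- `(x,y) ↦ G(x,y)` is measurable. [folklore] -/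
private theorem measurable_hlKernelDx₂ (L : ℝ) :
    Measurable fun p : ℝ × ℝ => hlKernelDx L p.1 p.2 := by
  unfold hlKernelDx
  have h1 : Measurable fun p : ℝ × ℝ => Real.tan (π * p.2 / L) :=
    (measurable_tan_phase L).comp measurable_snd
  have h2 : Measurable fun p : ℝ × ℝ => Real.sin (π * p.1 / L) ^ 2 := by fun_prop
  have h3 : Measurable fun p : ℝ × ℝ => hlKernelFnDeriv (hlRatio L p.1 p.2) :=
    measurable_hlKernelFnDeriv.comp (measurable_hlRatio₂ L)
  exact ((measurable_const.mul h1).div h2).mul h3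

/-- The band `{(x,y) ∈ (0,½L)² : tan(μx) < λ tan(μy), tan(μy) < λ tan(μx)}` is measurable. [folklore] -/
private theorem measurableSet_band (L lam : ℝ) :
    MeasurableSet {p : ℝ × ℝ | (p.1 ∈ Ioo 0 (L / 2) ∧ p.2 ∈ Ioo 0 (L / 2)) ∧
      (Real.tan (π * p.1 / L) < lam * Real.tan (π * p.2 / L) ∧
        Real.tan (π * p.2 / L) < lam * Real.tan (π * p.1 / L))} := by
  have h1 : Measurable fun p : ℝ × ℝ => Real.tan (π * p.1 / L) :=
    (measurable_tan_phase L).comp measurable_fst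
  have h2 : Measurable fun p : ℝ × ℝ => Real.tan (π * p.2 / L) :=
    (measurable_tan_phase L).comp measurable_snd
  exact ((measurable_fst measurableSet_Ioo).inter (measurable_snd measurableSet_Ioo)).inter
    ((measurableSet_lt h1 (measurable_const.mul h2)).inter
      (measurableSet_lt h2 (measurable_const.mul h1)))

/-! ### §3 Tonelli: `ω′(x)K(x,y)ω(y)cot(μy)` is integrable on `(a,½L) × (0,½L)`, and
`∫ₐ^{L/2} ω′Φ` is its double integral -/

/-- `∫₀^{L/2} K(x,·)ωcot = −π·u(x)cot(μx)` for `x ∈ (0, ½L)` (Lemma 6, set-integral form).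
[cite: ChoiHouKiselevLuoSverakYao2017, §4 Lemma 6 (eqn_u_ker)] -/
theorem setIntegral_kernel_eq {L : ℝ} (hL : 0 < L) {w : ℝ → ℝ} (hw : Continuous w)
    (hodd : ∀ y, w (-y) = -w y) (hper : Function.Periodic w L) {x : ℝ} (hx : x ∈ Ioo 0 (L / 2)) :
    ∫ y in Ioo 0 (L / 2), hlKernel L x y * (w y * Real.cot (π * y / L)) =
      -π * (periodicHLVelocity L w x * Real.cot (π * x / L)) := by
  rw [← integral_Ioc_eq_integral_Ioo, ← intervalIntegral.integral_of_le (by linarith [hx.2]),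
    periodicHLVelocity_mul_cot hL hw hodd hper hx]
  field_simp

/-- **Tonelli.** For `a ∈ (0, ½L)` and `ω ∈ C¹` odd `L`-periodic with `ω ≥ 0` on `[0, ½L]`, the
function `(x,y) ↦ ω′(x)K(x,y)ω(y)cot(μy)` is integrable on `(a, ½L) × (0, ½L)`: its sections are
integrable (`intervalIntegrable_kernelIntegrand`) and `∫₀^{L/2}|·|dy = |ω′(x)|·(−π u(x)cot(μx))` is
continuous on `[a, ½L]`. [cite: ChoiHouKiselevLuoSverakYao2017, §4 proof of Lemma 7, p. 12 (the double integral I₂)] -/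
theorem integrable_kernel_prod {L a : ℝ} (hL : 0 < L) (ha : a ∈ Ioo 0 (L / 2)) {w : ℝ → ℝ}
    (hw : ContDiff ℝ 1 w) (hodd : ∀ y, w (-y) = -w y) (hper : Function.Periodic w L)
    (hnn : ∀ y ∈ Icc 0 (L / 2), 0 ≤ w y) :
    Integrable (fun p : ℝ × ℝ =>
        deriv w p.1 * (hlKernel L p.1 p.2 * (w p.2 * Real.cot (π * p.2 / L))))
      ((volume.restrict (Ioo a (L / 2))).prod (volume.restrict (Ioo 0 (L / 2)))) := by
  have hL2 : a ≤ L / 2 := ha.2.le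
  have hw' : Continuous (deriv w) := hw.continuous_deriv le_rfl
  have hmeas : Measurable (fun p : ℝ × ℝ =>
      deriv w p.1 * (hlKernel L p.1 p.2 * (w p.2 * Real.cot (π * p.2 / L)))) :=
    (hw'.measurable.comp measurable_fst).mul ((measurable_hlKernel₂ L).mul
      ((hw.continuous.measurable.comp measurable_snd).mul
        ((measurable_cot_phase L).comp measurable_snd)))
  rw [integrable_prod_iff hmeas.aestronglyMeasurable]
  constructor
  · refine (ae_restrict_mem measurableSet_Ioo).mono fun x hx => ?_
    have hx0 : x ∈ Ioo 0 (L / 2) := ⟨ha.1.trans hx.1, hx.2⟩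
    have hint := intervalIntegrable_kernelIntegrand hL hw.continuous hx0
    rw [intervalIntegrable_iff_integrableOn_Ioc_of_le (by linarith [hx.2])] at hint
    exact (hint.mono_set Ioo_subset_Ioc_self).const_mul (deriv w x)
  · -- the `y`-integral of the absolute value is `|ω′(x)|·(−π u(x) cot(μx))`, continuous on `[a, ½L]`
    set u : ℝ → ℝ := periodicHLVelocity L w with hu
    have huc : Continuous u := continuous_periodicHLVelocity hL hw.continuous hper
    have hg : ContinuousOn (fun x => |deriv w x| * (-π * (u x * Real.cot (π * x / L))))
        (Icc a (L / 2)) := by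
      have hcot : ContinuousOn (fun x => Real.cot (π * x / L)) (Icc a (L / 2)) := by
        have h : (fun x => Real.cot (π * x / L)) =
            fun x => Real.cos (π * x / L) / Real.sin (π * x / L) :=
          funext fun x => Real.cot_eq_cos_div_sin _
        rw [h]
        refine ContinuousOn.div (by fun_prop) (by fun_prop) fun x hx => ?_
        exact (sin_phase_pos_of_mem_Ioc hL ⟨ha.1.trans_le hx.1, hx.2⟩).ne'
      exact ((continuous_abs.comp hw').continuousOn).mul
        (continuousOn_const.mul (huc.continuousOn.mul hcot))
    have hgi : Integrable (fun x => |deriv w x| * (-π * (u x * Real.cot (π * x / L))))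
        (volume.restrict (Ioo a (L / 2))) :=
      (hg.integrableOn_Icc.mono_set Ioo_subset_Icc_self)
    refine hgi.congr ?_
    refine (ae_restrict_mem measurableSet_Ioo).mono fun x hx => ?_
    have hx0 : x ∈ Ioo 0 (L / 2) := ⟨ha.1.trans hx.1, hx.2⟩
    have hpt : ∀ y ∈ Ioo 0 (L / 2),
        ‖deriv w x * (hlKernel L x y * (w y * Real.cot (π * y / L)))‖ =
          |deriv w x| * (hlKernel L x y * (w y * Real.cot (π * y / L))) := by
      intro y hy
      rw [Real.norm_eq_abs, abs_mul, abs_of_nonneg (mul_nonneg (hlKernel_nonneg hL hx0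
        ⟨hy.1.le, hy.2.le⟩) (mul_cot_nonneg₇ hL hnn ⟨hy.1.le, hy.2.le⟩))]
    simp only
    rw [setIntegral_congr_fun measurableSet_Ioo hpt, MeasureTheory.integral_const_mul,
      setIntegral_kernel_eq hL hw.continuous hodd hper hx0]

/-- **`∫ₐ^{L/2} ω′(x)Φ(x) dx` is the double integral** of `ω′(x)K(x,y)ω(y)cot(μy)` over
`(a,½L) × (0,½L)` (Fubini), `Φ(x) = ∫₀^{L/2} K(x,y)ω(y)cot(μy) dy`.
[cite: ChoiHouKiselevLuoSverakYao2017, §4 proof of Lemma 7, p. 12 (the double integral I₂)] -/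
theorem integral_kernel_prod_eq {L a : ℝ} (hL : 0 < L) (ha : a ∈ Ioo 0 (L / 2)) {w : ℝ → ℝ}
    (hw : ContDiff ℝ 1 w) (hodd : ∀ y, w (-y) = -w y) (hper : Function.Periodic w L)
    (hnn : ∀ y ∈ Icc 0 (L / 2), 0 ≤ w y) :
    ∫ p, deriv w p.1 * (hlKernel L p.1 p.2 * (w p.2 * Real.cot (π * p.2 / L)))
        ∂((volume.restrict (Ioo a (L / 2))).prod (volume.restrict (Ioo 0 (L / 2)))) =
      ∫ x in a..L / 2, deriv w x *
        ∫ y in (0 : ℝ)..L / 2, hlKernel L x y * (w y * Real.cot (π * y / L)) := by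
  rw [integral_prod _ (integrable_kernel_prod hL ha hw hodd hper hnn),
    intervalIntegral.integral_of_le ha.2.le, integral_Ioc_eq_integral_Ioo]
  refine setIntegral_congr_fun measurableSet_Ioo fun x _ => ?_
  simp only
  rw [MeasureTheory.integral_const_mul, intervalIntegral.integral_of_le (by linarith [ha.2]),
    integral_Ioc_eq_integral_Ioo]

/-! ### §4 The `x`-integration by parts off the band, one `y` at a time -/

/-- `s(x,y) ≠ 1` for `x ≠ y` in `(0, ½L)`. [cite: ChoiHouKiselevLuoSverakYao2017, §4 Lemma 6 (eqn_u_ker)] -/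
theorem hlRatio_ne_one {L x y : ℝ} (hL : 0 < L) (hx : x ∈ Ioo 0 (L / 2)) (hy : y ∈ Ioo 0 (L / 2))
    (hxy : x ≠ y) : hlRatio L x y ≠ 1 := by
  intro h
  rw [hlRatio, div_eq_one_iff_eq (tan_phase_pos_of_mem_Ioo hL hx).ne'] at h
  exact hxy (tan_phase_inj hL hx hy h.symm)

/-- `s(½L, y) = 0` (Lean's `tan(π/2) = 0`; the cos/sin form). [cite: ChoiHouKiselevLuoSverakYao2017, §4 Lemma 6 (eqn_u_ker)] -/
theorem hlRatio_half_left {L : ℝ} (hL : 0 < L) (y : ℝ) : hlRatio L (L / 2) y = 0 := by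
  rw [hlRatio_eq_mul_cos_div_sin, show π * (L / 2) / L = π / 2 by field_simp, Real.cos_pi_div_two,
    mul_zero, zero_div]

/-- `K(½L, y) = 0`. [cite: ChoiHouKiselevLuoSverakYao2017, §4 Lemma 6 (eqn_u_ker)] -/
theorem hlKernel_half_left {L : ℝ} (hL : 0 < L) (y : ℝ) : hlKernel L (L / 2) y = 0 := by
  rw [hlKernel, hlRatio_half_left hL, hlKernelFn, zero_mul]

/-- **Integration by parts on a piece `[c,d] ⊂ (0, ½L]` off the diagonal**:
`∫_c^d ω′K(·,y) = ω(d)K(d,y) − ω(c)K(c,y) − ∫_c^d ωG(·,y)` (`K_x = G` in the interior, `K(·,y)`,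
`G(·,y)` continuous on the closed piece). [cite: ChoiHouKiselevLuoSverakYao2017, §4 proof of Lemma 7, p. 12 (integration by parts, G = K_x)] -/
theorem integral_deriv_mul_hlKernel_piece {L y c d : ℝ} (hL : 0 < L) (hy : y ∈ Ioo 0 (L / 2))
    {w : ℝ → ℝ} (hw : ContDiff ℝ 1 w) (hc : 0 < c) (hcd : c ≤ d) (hd : d ≤ L / 2)
    (hoff : ∀ x ∈ Icc c d, hlRatio L x y ≠ 1) (hne : ∀ x ∈ Ioo c d, x ≠ y) :
    ∫ x in c..d, deriv w x * hlKernel L x y =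
      w d * hlKernel L d y - w c * hlKernel L c y - ∫ x in c..d, w x * hlKernelDx L x y := by
  have hyI : y ∈ Icc 0 (L / 2) := ⟨hy.1.le, hy.2.le⟩
  have hsub : Icc c d ⊆ {x | x ∈ Ioc 0 (L / 2) ∧ hlRatio L x y ≠ 1} :=
    fun x hx => ⟨⟨hc.trans_le hx.1, hx.2.trans hd⟩, hoff x hx⟩
  have hK : ContinuousOn (fun x => hlKernel L x y) (Icc c d) :=
    (continuousOn_hlKernel_left hL hyI).mono hsub
  have hG : ContinuousOn (fun x => hlKernelDx L x y) (Icc c d) :=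
    (continuousOn_hlKernelDx_left hL hyI).mono hsub
  have h := intervalIntegral.integral_mul_deriv_eq_deriv_mul_of_hasDeriv_right (a := c) (b := d)
    (u := w) (v := fun x => hlKernel L x y) (u' := deriv w) (v' := fun x => hlKernelDx L x y)
    hw.continuous.continuousOn (by rwa [uIcc_of_le hcd])
    (fun x _ => ((hw.differentiable (by norm_num)).differentiableAt.hasDerivAt).hasDerivWithinAt)
    (fun x hx => by
      rw [min_eq_left hcd, max_eq_right hcd] at hx
      exact (hasDerivAt_hlKernel_left hL ⟨hc.trans hx.1, hx.2.trans_le hd⟩ hy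
        (hne x hx)).hasDerivWithinAt)
    ((hw.continuous_deriv le_rfl).intervalIntegrable _ _) (hG.intervalIntegrable_of_Icc hcd)
  linarith

/-- **Conversion**: for `y ∈ (0,½L)` and a measurable `x`-set structure, the integral over
`{x ∈ (a,½L) : (x,y) ∉ B_λ}` of `P(·,y)` is `∫ₐ^{c₁} P + ∫_{c₂}^{L/2} P`, `c₁ = max(a, x₋(y))`,
`c₂ = max(a, x₊(y))`, for `P(·,y)` integrable on the two closed pieces. [folklore] -/
private theorem setIntegral_offband_eq {L lam a y : ℝ} (hL : 0 < L) (hlam : 1 < lam)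
    (ha : a ∈ Ioo 0 (L / 2)) (hy : y ∈ Ioo 0 (L / 2)) {P : ℝ × ℝ → ℝ}
    (h₁ : IntegrableOn (fun x => P (x, y))
      (Icc a (max a (L / π * Real.arctan (Real.tan (π * y / L) / lam)))) volume)
    (h₂ : IntegrableOn (fun x => P (x, y))
      (Icc (max a (L / π * Real.arctan (lam * Real.tan (π * y / L)))) (L / 2)) volume) :
    ∫ x in Ioo a (L / 2), {p : ℝ × ℝ | (p.1 ∈ Ioo 0 (L / 2) ∧ p.2 ∈ Ioo 0 (L / 2)) ∧
        (Real.tan (π * p.1 / L) < lam * Real.tan (π * p.2 / L) ∧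
          Real.tan (π * p.2 / L) < lam * Real.tan (π * p.1 / L))}ᶜ.indicator P (x, y) =
      (∫ x in a..max a (L / π * Real.arctan (Real.tan (π * y / L) / lam)), P (x, y)) +
        ∫ x in max a (L / π * Real.arctan (lam * Real.tan (π * y / L)))..L / 2, P (x, y) := by
  obtain ⟨⟨hm, -, hmy⟩, ⟨hp, -, hyp⟩⟩ := cut_points hL hlam hy
  set xm := L / π * Real.arctan (Real.tan (π * y / L) / lam) with hxm
  set xp := L / π * Real.arctan (lam * Real.tan (π * y / L)) with hxp
  set T : Set ℝ := Iic xm ∪ Ici xp with hT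
  have hTm : MeasurableSet T := measurableSet_Iic.union measurableSet_Ici
  -- Step 1: on `(a, ½L)` the indicator of `Bᶜ` is the indicator of `T`
  have h1 : ∫ x in Ioo a (L / 2), {p : ℝ × ℝ | (p.1 ∈ Ioo 0 (L / 2) ∧ p.2 ∈ Ioo 0 (L / 2)) ∧
        (Real.tan (π * p.1 / L) < lam * Real.tan (π * p.2 / L) ∧
          Real.tan (π * p.2 / L) < lam * Real.tan (π * p.1 / L))}ᶜ.indicator P (x, y) =
      ∫ x in Ioo a (L / 2), T.indicator (fun x => P (x, y)) x := by
    refine setIntegral_congr_fun measurableSet_Ioo fun x hx => ?_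
    have hx0 : x ∈ Ioo 0 (L / 2) := ⟨ha.1.trans hx.1, hx.2⟩
    have hiff := band_iff_cuts hL hlam hx0 hy
    by_cases hxT : x ∈ T
    · have hnot : (x, y) ∈ {p : ℝ × ℝ | (p.1 ∈ Ioo 0 (L / 2) ∧ p.2 ∈ Ioo 0 (L / 2)) ∧
          (Real.tan (π * p.1 / L) < lam * Real.tan (π * p.2 / L) ∧
            Real.tan (π * p.2 / L) < lam * Real.tan (π * p.1 / L))}ᶜ := by
        rw [mem_compl_iff, mem_setOf_eq]
        rintro ⟨-, hb⟩
        have hb' := hiff.1 hb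
        rcases hxT with h | h
        · exact absurd (mem_Iic.1 h) (not_le.2 hb'.1)
        · exact absurd (mem_Ici.1 h) (not_le.2 hb'.2)
      rw [indicator_of_mem hnot, indicator_of_mem hxT]
    · have hin : (x, y) ∉ {p : ℝ × ℝ | (p.1 ∈ Ioo 0 (L / 2) ∧ p.2 ∈ Ioo 0 (L / 2)) ∧
          (Real.tan (π * p.1 / L) < lam * Real.tan (π * p.2 / L) ∧
            Real.tan (π * p.2 / L) < lam * Real.tan (π * p.1 / L))}ᶜ := by
        rw [mem_compl_iff, not_not, mem_setOf_eq]
        refine ⟨⟨hx0, hy⟩, hiff.2 ⟨?_, ?_⟩⟩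
        · by_contra h
          exact hxT (Or.inl (mem_Iic.2 (not_lt.1 h)))
        · by_contra h
          exact hxT (Or.inr (mem_Ici.2 (not_lt.1 h)))
      rw [indicator_of_notMem hin, indicator_of_notMem hxT]
  rw [h1, MeasureTheory.integral_indicator hTm, Measure.restrict_restrict hTm]
  -- Step 2: `T ∩ (a, ½L) = (a, x₋] ∪ ([x₊, ∞) ∩ (a, ½L))`, a disjoint union
  have hset : T ∩ Ioo a (L / 2) = Ioc a xm ∪ (Ici xp ∩ Ioo a (L / 2)) := by
    ext x
    simp only [hT, mem_inter_iff, mem_union, mem_Iic, mem_Ici, mem_Ioo, mem_Ioc]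
    constructor
    · rintro ⟨h | h, h1, h2⟩
      · exact Or.inl ⟨h1, h⟩
      · exact Or.inr ⟨h, h1, h2⟩
    · rintro (⟨h1, h⟩ | ⟨h, h1, h2⟩)
      · exact ⟨Or.inl h, h1, lt_of_le_of_lt h (hmy.trans hy.2)⟩
      · exact ⟨Or.inr h, h1, h2⟩
  have hdisj : Disjoint (Ioc a xm) (Ici xp ∩ Ioo a (L / 2)) := by
    rw [Set.disjoint_left]
    rintro x ⟨-, hx1⟩ ⟨hx2, -⟩
    have : xm < xp := hmy.trans hyp
    exact absurd (hx2.trans hx1) (not_le.2 this)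
  have hi₁ : IntegrableOn (fun x => P (x, y)) (Ioc a xm) volume := by
    rcases le_or_gt a xm with h | h
    · rw [max_eq_right h] at h₁
      exact h₁.mono_set Ioc_subset_Icc_self
    · rw [Ioc_eq_empty (not_lt.2 h.le)]
      exact integrableOn_empty
  have hi₂ : IntegrableOn (fun x => P (x, y)) (Ici xp ∩ Ioo a (L / 2)) volume := by
    refine h₂.mono_set fun x hx => ⟨max_le hx.2.1.le hx.1, hx.2.2.le⟩
  rw [hset, setIntegral_union hdisj (measurableSet_Ici.inter measurableSet_Ioo) hi₁ hi₂]
  congr 1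
  · rcases le_or_gt a xm with h | h
    · rw [max_eq_right h, intervalIntegral.integral_of_le h]
    · rw [Ioc_eq_empty (not_lt.2 h.le), setIntegral_empty, max_eq_left h.le,
        intervalIntegral.integral_same]
  · rcases le_or_gt xp a with h | h
    · have e : Ici xp ∩ Ioo a (L / 2) = Ioo a (L / 2) := by
        ext x
        simp only [mem_inter_iff, mem_Ici, mem_Ioo]
        exact ⟨fun h' => h'.2, fun h' => ⟨h.trans h'.1.le, h'⟩⟩
      rw [e, max_eq_left h, intervalIntegral.integral_of_le ha.2.le, integral_Ioc_eq_integral_Ioo]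
    · have e : Ici xp ∩ Ioo a (L / 2) = Ico xp (L / 2) := by
        ext x
        simp only [mem_inter_iff, mem_Ici, mem_Ioo, mem_Ico]
        exact ⟨fun h' => ⟨h'.1, h'.2.2⟩, fun h' => ⟨h'.1, h.trans_le h'.1, h'.2⟩⟩
      rw [e, max_eq_right h.le, intervalIntegral.integral_of_le hp.2.le, integral_Ioc_eq_integral_Ioo,
        integral_Ico_eq_integral_Ioo]

/-- **The per-`y` identity** (for a.e. `y`: `y ∈ (0,½L)`, `y ≠ a`): the off-band `x`-integral of
`ω′(x)K(x,y)ω(y)cot(μy)` over `(a,½L)` equals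
`ω(y)cot(μy)·[ω(c₁)K(c₁,y) − ω(a)K(a,y) − ω(c₂)K(c₂,y)]` minus the off-band `x`-integral of
`ω(x)G(x,y)ω(y)cot(μy)` (`c₁ = max(a,x₋(y))`, `c₂ = max(a,x₊(y))`, `ω(½L) = 0`).
[cite: ChoiHouKiselevLuoSverakYao2017, §4 proof of Lemma 7, p. 12 (integration by parts, G = K_x)] -/
theorem inner_offband_eq {L lam a y : ℝ} (hL : 0 < L) (hlam : 1 < lam) (ha : a ∈ Ioo 0 (L / 2))
    (hy : y ∈ Ioo 0 (L / 2)) (hya : y ≠ a) {w : ℝ → ℝ} (hw : ContDiff ℝ 1 w)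
    (hwH : w (L / 2) = 0) :
    ∫ x in Ioo a (L / 2), {p : ℝ × ℝ | (p.1 ∈ Ioo 0 (L / 2) ∧ p.2 ∈ Ioo 0 (L / 2)) ∧
        (Real.tan (π * p.1 / L) < lam * Real.tan (π * p.2 / L) ∧
          Real.tan (π * p.2 / L) < lam * Real.tan (π * p.1 / L))}ᶜ.indicator
        (fun p : ℝ × ℝ => deriv w p.1 * (hlKernel L p.1 p.2 * (w p.2 * Real.cot (π * p.2 / L))))
        (x, y) =
      w y * Real.cot (π * y / L) *
          (w (max a (L / π * Real.arctan (Real.tan (π * y / L) / lam))) *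
              hlKernel L (max a (L / π * Real.arctan (Real.tan (π * y / L) / lam))) y -
            w a * hlKernel L a y -
            w (max a (L / π * Real.arctan (lam * Real.tan (π * y / L)))) *
              hlKernel L (max a (L / π * Real.arctan (lam * Real.tan (π * y / L)))) y) -
        ∫ x in Ioo a (L / 2), {p : ℝ × ℝ | (p.1 ∈ Ioo 0 (L / 2) ∧ p.2 ∈ Ioo 0 (L / 2)) ∧
            (Real.tan (π * p.1 / L) < lam * Real.tan (π * p.2 / L) ∧
              Real.tan (π * p.2 / L) < lam * Real.tan (π * p.1 / L))}ᶜ.indicator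
          (fun p : ℝ × ℝ => w p.1 * (hlKernelDx L p.1 p.2 * (w p.2 * Real.cot (π * p.2 / L))))
          (x, y) := by
  obtain ⟨⟨hm, htm, hmy⟩, ⟨hp, htp, hyp⟩⟩ := cut_points hL hlam hy
  set xm := L / π * Real.arctan (Real.tan (π * y / L) / lam) with hxm
  set xp := L / π * Real.arctan (lam * Real.tan (π * y / L)) with hxp
  set c₁ := max a xm with hc₁
  set c₂ := max a xp with hc₂
  set f : ℝ := w y * Real.cot (π * y / L) with hf
  have hyI : y ∈ Icc 0 (L / 2) := ⟨hy.1.le, hy.2.le⟩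
  have hlam0 : 0 < lam := by linarith
  have hty := tan_phase_pos_of_mem_Ioo hL hy
  have hc₁I : c₁ ∈ Ioo 0 (L / 2) := ⟨ha.1.trans_le (le_max_left _ _), max_lt ha.2 hm.2⟩
  have hc₂I : c₂ ∈ Ioo 0 (L / 2) := ⟨ha.1.trans_le (le_max_left _ _), max_lt ha.2 hp.2⟩
  -- off-diagonal conditions on the two pieces
  have hoff₁ : ∀ x ∈ Icc a c₁, hlRatio L x y ≠ 1 := by
    intro x hx
    have hx0 : x ∈ Ioo 0 (L / 2) := ⟨ha.1.trans_le hx.1, hx.2.trans_lt hc₁I.2⟩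
    refine hlRatio_ne_one hL hx0 hy fun hxy => ?_
    rw [hxy] at hx
    rcases le_or_gt a xm with h | h
    · rw [hc₁, max_eq_right h] at hx
      exact absurd hx.2 (not_le.2 hmy)
    · rw [hc₁, max_eq_left h.le] at hx
      exact hya (le_antisymm hx.2 hx.1)
  have hne₁ : ∀ x ∈ Ioo a c₁, x ≠ y := by
    intro x hx hxy
    exact hoff₁ x ⟨hx.1.le, hx.2.le⟩ (by rw [hxy, hlRatio, div_self hty.ne'])
  have hoff₂ : ∀ x ∈ Icc c₂ (L / 2), hlRatio L x y ≠ 1 := by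
    intro x hx
    rcases eq_or_lt_of_le hx.2 with h | h
    · rw [h, hlRatio_half_left hL]; norm_num
    · have hx0 : x ∈ Ioo 0 (L / 2) := ⟨hc₂I.1.trans_le hx.1, h⟩
      refine hlRatio_ne_one hL hx0 hy fun hxy => ?_
      rw [hxy] at hx
      exact absurd ((le_max_right a xp).trans hx.1) (not_le.2 hyp)
  have hne₂ : ∀ x ∈ Ioo c₂ (L / 2), x ≠ y := by
    intro x hx hxy
    exact hoff₂ x ⟨hx.1.le, hx.2.le⟩ (by rw [hxy, hlRatio, div_self hty.ne'])
  -- continuity of `K(·,y)`, `G(·,y)` on the pieces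
  have hsub₁ : Icc a c₁ ⊆ {x | x ∈ Ioc 0 (L / 2) ∧ hlRatio L x y ≠ 1} :=
    fun x hx => ⟨⟨ha.1.trans_le hx.1, hx.2.trans hc₁I.2.le⟩, hoff₁ x hx⟩
  have hsub₂ : Icc c₂ (L / 2) ⊆ {x | x ∈ Ioc 0 (L / 2) ∧ hlRatio L x y ≠ 1} :=
    fun x hx => ⟨⟨hc₂I.1.trans_le hx.1, hx.2⟩, hoff₂ x hx⟩
  have hK₁ : ContinuousOn (fun x => hlKernel L x y) (Icc a c₁) :=
    (continuousOn_hlKernel_left hL hyI).mono hsub₁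
  have hK₂ : ContinuousOn (fun x => hlKernel L x y) (Icc c₂ (L / 2)) :=
    (continuousOn_hlKernel_left hL hyI).mono hsub₂
  have hG₁ : ContinuousOn (fun x => hlKernelDx L x y) (Icc a c₁) :=
    (continuousOn_hlKernelDx_left hL hyI).mono hsub₁
  have hG₂ : ContinuousOn (fun x => hlKernelDx L x y) (Icc c₂ (L / 2)) :=
    (continuousOn_hlKernelDx_left hL hyI).mono hsub₂
  have hwc : Continuous w := hw.continuous
  have hw'c : Continuous (deriv w) := hw.continuous_deriv le_rfl
  have hF₁ : ContinuousOn (fun x => deriv w x * (hlKernel L x y * (w y * Real.cot (π * y / L))))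
      (Icc a c₁) := hw'c.continuousOn.mul (hK₁.mul continuousOn_const)
  have hF₂ : ContinuousOn (fun x => deriv w x * (hlKernel L x y * (w y * Real.cot (π * y / L))))
      (Icc c₂ (L / 2)) := hw'c.continuousOn.mul (hK₂.mul continuousOn_const)
  have hQ₁ : ContinuousOn (fun x => w x * (hlKernelDx L x y * (w y * Real.cot (π * y / L))))
      (Icc a c₁) := hwc.continuousOn.mul (hG₁.mul continuousOn_const)
  have hQ₂ : ContinuousOn (fun x => w x * (hlKernelDx L x y * (w y * Real.cot (π * y / L))))
      (Icc c₂ (L / 2)) := hwc.continuousOn.mul (hG₂.mul continuousOn_const)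
  -- conversion of both off-band integrals
  have eF := setIntegral_offband_eq hL hlam ha hy
    (P := fun p : ℝ × ℝ => deriv w p.1 * (hlKernel L p.1 p.2 * (w p.2 * Real.cot (π * p.2 / L))))
    hF₁.integrableOn_Icc hF₂.integrableOn_Icc
  have eQ := setIntegral_offband_eq hL hlam ha hy
    (P := fun p : ℝ × ℝ => w p.1 * (hlKernelDx L p.1 p.2 * (w p.2 * Real.cot (π * p.2 / L))))
    hQ₁.integrableOn_Icc hQ₂.integrableOn_Icc
  rw [eF, eQ]
  simp only
  -- pull the constant `f = ω(y)cot(μy)` out and integrate by parts on each piece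
  have pull : ∀ (g : ℝ → ℝ) (c d : ℝ), ∫ x in c..d, g x * (w y * Real.cot (π * y / L)) =
      f * ∫ x in c..d, g x := by
    intro g c d
    rw [← intervalIntegral.integral_const_mul]
    refine intervalIntegral.integral_congr fun x _ => ?_
    simp only [hf]
    ring
  have e1 : ∫ x in a..c₁, deriv w x * (hlKernel L x y * (w y * Real.cot (π * y / L))) =
      f * ∫ x in a..c₁, deriv w x * hlKernel L x y := by
    rw [← pull]; simp_rw [mul_assoc]
  have e2 : ∫ x in c₂..L / 2, deriv w x * (hlKernel L x y * (w y * Real.cot (π * y / L))) =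
      f * ∫ x in c₂..L / 2, deriv w x * hlKernel L x y := by
    rw [← pull]; simp_rw [mul_assoc]
  have e3 : ∫ x in a..c₁, w x * (hlKernelDx L x y * (w y * Real.cot (π * y / L))) =
      f * ∫ x in a..c₁, w x * hlKernelDx L x y := by
    rw [← pull]; simp_rw [mul_assoc]
  have e4 : ∫ x in c₂..L / 2, w x * (hlKernelDx L x y * (w y * Real.cot (π * y / L))) =
      f * ∫ x in c₂..L / 2, w x * hlKernelDx L x y := by
    rw [← pull]; simp_rw [mul_assoc]
  rw [e1, e2, e3, e4,
    integral_deriv_mul_hlKernel_piece hL hy hw ha.1 (le_max_left _ _) hc₁I.2.le hoff₁ hne₁,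
    integral_deriv_mul_hlKernel_piece hL hy hw hc₂I.1 hc₂I.2.le le_rfl hoff₂ hne₂, hwH]
  ring

/-! ### §5 The off-band double integrals: integrability, the swap symmetry, the sign -/

/-- Off the band `s ∉ (λ⁻¹, λ)` (`λ = 1+δ`) the pairs of `(a,½L) × (0,½L)` have `s ≥ 0` and
`s ≤ λ⁻¹ ∨ λ ≤ s`. [folklore] -/
private theorem offband_ratio {L lam x y : ℝ} (hL : 0 < L) (hlam : 0 < lam) (hx : x ∈ Ioo 0 (L / 2))
    (hy : y ∈ Ioo 0 (L / 2))
    (hnot : (x, y) ∉ {p : ℝ × ℝ | (p.1 ∈ Ioo 0 (L / 2) ∧ p.2 ∈ Ioo 0 (L / 2)) ∧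
      (Real.tan (π * p.1 / L) < lam * Real.tan (π * p.2 / L) ∧
        Real.tan (π * p.2 / L) < lam * Real.tan (π * p.1 / L))}) :
    hlRatio L x y ≤ 1 / lam ∨ lam ≤ hlRatio L x y := by
  have htx := tan_phase_pos_of_mem_Ioo hL hx
  rw [mem_setOf_eq, not_and] at hnot
  have h := hnot ⟨hx, hy⟩
  rw [not_and_or, not_lt, not_lt] at h
  rcases h with h | h
  · left
    rw [hlRatio, div_le_div_iff₀ htx hlam, one_mul, mul_comm]
    exact h
  · right
    rw [hlRatio, le_div_iff₀ htx]
    exact h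

/-- A pair of `(0,½L)²` off the band has distinct coordinates (the diagonal `s = 1` lies inside
the band). [folklore] -/
private theorem offband_ne {L lam x y : ℝ} (hL : 0 < L) (hlam : 1 < lam) (hx : x ∈ Ioo 0 (L / 2))
    (hy : y ∈ Ioo 0 (L / 2))
    (hnot : (x, y) ∉ {p : ℝ × ℝ | (p.1 ∈ Ioo 0 (L / 2) ∧ p.2 ∈ Ioo 0 (L / 2)) ∧
      (Real.tan (π * p.1 / L) < lam * Real.tan (π * p.2 / L) ∧
        Real.tan (π * p.2 / L) < lam * Real.tan (π * p.1 / L))}) :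
    x ≠ y := by
  rintro rfl
  have htx := tan_phase_pos_of_mem_Ioo hL hx
  exact hnot ⟨⟨hx, hx⟩, lt_mul_of_one_lt_left htx hlam, lt_mul_of_one_lt_left htx hlam⟩

/-- A uniform bound for `ω` on `[0, ½L]`. [folklore] -/
private theorem exists_bound_Icc {w : ℝ → ℝ} (hw : Continuous w) (L : ℝ) :
    ∃ M, 0 ≤ M ∧ ∀ z ∈ Icc 0 (L / 2), |w z| ≤ M := by
  obtain ⟨M, hM⟩ := isCompact_Icc.exists_bound_of_continuousOn (hw.continuousOn (s := Icc 0 (L / 2)))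
  refine ⟨max M 0, le_max_right _ _, fun z hz => ?_⟩
  have h := hM z hz
  rw [Real.norm_eq_abs] at h
  exact h.trans (le_max_left _ _)

/-- **Off the band the `G`-integrand is bounded, hence integrable**: on
`{(x,y) ∈ (a,½L)×(0,½L) : s ∉ (λ⁻¹,λ)}`, `|ω(x)G(x,y)ω(y)cot(μy)| = μ|ω(x)||ω(y)||φ′(s)|/sin²(μx)
≤ μM²C_δ/sin²(μa)` (`mul_cot_mul_hlKernelDx`, `abs_hlKernelFnDeriv_le`).
[cite: ChoiHouKiselevLuoSverakYao2017, §4 proof of Lemma 7, p. 12 (the double integral ∫∫ωωcot G)] -/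
theorem integrableOn_offband_dx {L a δ : ℝ} (hL : 0 < L) (ha : a ∈ Ioo 0 (L / 2)) (hδ : 0 < δ)
    {w : ℝ → ℝ} (hw : ContDiff ℝ 1 w) :
    IntegrableOn (fun p : ℝ × ℝ =>
        w p.1 * (hlKernelDx L p.1 p.2 * (w p.2 * Real.cot (π * p.2 / L))))
      {p : ℝ × ℝ | (p.1 ∈ Ioo 0 (L / 2) ∧ p.2 ∈ Ioo 0 (L / 2)) ∧
        (Real.tan (π * p.1 / L) < (1 + δ) * Real.tan (π * p.2 / L) ∧
          Real.tan (π * p.2 / L) < (1 + δ) * Real.tan (π * p.1 / L))}ᶜ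
      ((volume.restrict (Ioo a (L / 2))).prod (volume.restrict (Ioo 0 (L / 2)))) := by
  obtain ⟨M, hM0, hM⟩ := exists_bound_Icc hw.continuous L
  set C : ℝ := Real.log ((2 + δ) / δ) + 2 * (1 + δ) / (δ * (2 + δ)) with hC
  set S : ℝ := Real.sin (π * a / L) ^ 2 with hS
  have hSa : 0 < Real.sin (π * a / L) := sin_phase_pos_of_mem_Ioc hL ⟨ha.1, ha.2.le⟩
  have hS0 : 0 < S := pow_pos hSa 2
  have hC0 : 0 ≤ C := (abs_nonneg _).trans (abs_hlKernelFnDeriv_le hδ (le_refl (0 : ℝ))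
    (Or.inl (by positivity)))
  have hmeas : Measurable (fun p : ℝ × ℝ =>
      w p.1 * (hlKernelDx L p.1 p.2 * (w p.2 * Real.cot (π * p.2 / L)))) :=
    (hw.continuous.measurable.comp measurable_fst).mul ((measurable_hlKernelDx₂ L).mul
      ((hw.continuous.measurable.comp measurable_snd).mul
        ((measurable_cot_phase L).comp measurable_snd)))
  have hBm := measurableSet_band L (1 + δ)
  have hsq : ∀ᵐ p ∂((volume.restrict (Ioo a (L / 2))).prod (volume.restrict (Ioo 0 (L / 2)))),
      p ∈ Ioo a (L / 2) ×ˢ Ioo 0 (L / 2) := by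
    rw [Measure.prod_restrict]
    exact ae_restrict_mem (measurableSet_Ioo.prod measurableSet_Ioo)
  rw [IntegrableOn]
  refine Integrable.mono' (integrable_const (M * (π / L * M * C / S)))
    hmeas.aestronglyMeasurable ?_
  filter_upwards [ae_restrict_mem hBm.compl, ae_restrict_of_ae hsq] with p hpB hpS
  obtain ⟨hx, hy⟩ := mem_prod.1 hpS
  have hx0 : p.1 ∈ Ioo 0 (L / 2) := ⟨ha.1.trans hx.1, hx.2⟩
  have hoff := offband_ratio hL (by linarith : (0 : ℝ) < 1 + δ) hx0 hy hpB
  have hφ : |hlKernelFnDeriv (hlRatio L p.1 p.2)| ≤ C :=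
    abs_hlKernelFnDeriv_le hδ (hlRatio_nonneg hL hx0 ⟨hy.1.le, hy.2.le⟩) hoff
  have hid := mul_cot_mul_hlKernelDx hL w hy p.1
  have hsin : S ≤ Real.sin (π * p.1 / L) ^ 2 := by
    have hpa := phase_Ioo₇ hL ha
    have hpx := phase_Ioo₇ hL hx0
    have h1 : Real.sin (π * a / L) ≤ Real.sin (π * p.1 / L) :=
      Real.sin_le_sin_of_le_of_le_pi_div_two (by linarith [hpa.1, Real.pi_pos]) hpx.2.le
        (div_le_div_of_nonneg_right (mul_le_mul_of_nonneg_left hx.1.le Real.pi_pos.le) hL.le)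
    exact pow_le_pow_left₀ hSa.le h1 2
  have hsx : 0 < Real.sin (π * p.1 / L) ^ 2 := hS0.trans_le hsin
  rw [Real.norm_eq_abs, show w p.1 * (hlKernelDx L p.1 p.2 * (w p.2 * Real.cot (π * p.2 / L))) =
    w p.1 * (w p.2 * Real.cot (π * p.2 / L) * hlKernelDx L p.1 p.2) by ring, hid, abs_mul]
  have h2 : |-(π / L) * w p.2 * hlKernelFnDeriv (hlRatio L p.1 p.2) / Real.sin (π * p.1 / L) ^ 2| ≤
      π / L * M * C / S := by
    rw [abs_div, abs_of_pos hsx, abs_mul, abs_mul, abs_neg, abs_of_pos (div_pos Real.pi_pos hL)]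
    rw [div_le_div_iff₀ hsx hS0]
    have h3 : π / L * |w p.2| * |hlKernelFnDeriv (hlRatio L p.1 p.2)| ≤ π / L * M * C :=
      mul_le_mul (mul_le_mul_of_nonneg_left (hM p.2 ⟨hy.1.le, hy.2.le⟩) (div_pos Real.pi_pos hL).le)
        hφ (abs_nonneg _) (by positivity)
    calc π / L * |w p.2| * |hlKernelFnDeriv (hlRatio L p.1 p.2)| * S
        ≤ π / L * M * C * S := mul_le_mul_of_nonneg_right h3 hS0.le
      _ ≤ π / L * M * C * Real.sin (π * p.1 / L) ^ 2 := mul_le_mul_of_nonneg_left hsin (by positivity)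
  exact mul_le_mul (hM p.1 ⟨hx0.1.le, hx0.2.le⟩) h2 (abs_nonneg _) hM0

/-- The measure `(vol|(a,½L)) ⊗ (vol|(0,½L))` restricted to `{y > a}` is `(vol|(a,½L))^{⊗2}`. [folklore] -/
private theorem prod_restrict_upper {L a : ℝ} (ha : 0 < a) :
    ((volume.restrict (Ioo a (L / 2))).prod (volume.restrict (Ioo 0 (L / 2)))).restrict
        {p : ℝ × ℝ | p.2 ≤ a}ᶜ =
      (volume.restrict (Ioo a (L / 2))).prod (volume.restrict (Ioo a (L / 2))) := by
  have e : ({p : ℝ × ℝ | p.2 ≤ a}ᶜ : Set (ℝ × ℝ)) = (univ : Set ℝ) ×ˢ Ioi a := by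
    ext p
    simp only [mem_compl_iff, mem_setOf_eq, not_le, mem_prod, mem_univ, true_and, mem_Ioi]
  rw [e, ← Measure.prod_restrict, Measure.restrict_univ, Measure.restrict_restrict measurableSet_Ioi]
  congr 2
  ext x
  simp only [mem_inter_iff, mem_Ioi, mem_Ioo]
  exact ⟨fun h => ⟨h.1, h.2.2⟩, fun h => ⟨h.1, ha.trans h.1, h.2⟩⟩

/-- **The sign of the off-band `G`-integral** (`= −Σ_δ ≤ 0`): on `y ≤ a < x` the integrand
`ω(x)G(x,y)ω(y)cot(μy)` is `≤ 0` pointwise (Lemma 6 (c): `K_x ≤ 0` below the diagonal); on the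
swap-symmetric region `{(x,y) ∈ (a,½L)² : s ∉ (λ⁻¹,λ)}` the integral equals
`½∫∫ ω(x)ω(y)T(x,y) ≤ 0`, `T ≤ 0` as printed ((eqn_ww_s)).
[cite: ChoiHouKiselevLuoSverakYao2017, §4 proof of Lemma 7, p. 12 (I₂ = (1/2π)∫∫ ω_r(x)ω_r(y)T(x,y) ≥ 0)] -/
theorem setIntegral_offband_dx_nonpos {L a δ : ℝ} (hL : 0 < L) (ha : a ∈ Ioo 0 (L / 2))
    (hδ : 0 < δ) {w : ℝ → ℝ} (hw : ContDiff ℝ 1 w) (hnn : ∀ y ∈ Icc 0 (L / 2), 0 ≤ w y) :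
    ∫ p in {p : ℝ × ℝ | (p.1 ∈ Ioo 0 (L / 2) ∧ p.2 ∈ Ioo 0 (L / 2)) ∧
        (Real.tan (π * p.1 / L) < (1 + δ) * Real.tan (π * p.2 / L) ∧
          Real.tan (π * p.2 / L) < (1 + δ) * Real.tan (π * p.1 / L))}ᶜ,
        w p.1 * (hlKernelDx L p.1 p.2 * (w p.2 * Real.cot (π * p.2 / L)))
      ∂((volume.restrict (Ioo a (L / 2))).prod (volume.restrict (Ioo 0 (L / 2)))) ≤ 0 := by
  set B : Set (ℝ × ℝ) := {p : ℝ × ℝ | (p.1 ∈ Ioo 0 (L / 2) ∧ p.2 ∈ Ioo 0 (L / 2)) ∧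
    (Real.tan (π * p.1 / L) < (1 + δ) * Real.tan (π * p.2 / L) ∧
      Real.tan (π * p.2 / L) < (1 + δ) * Real.tan (π * p.1 / L))} with hB
  set Q : ℝ × ℝ → ℝ := fun p =>
    w p.1 * (hlKernelDx L p.1 p.2 * (w p.2 * Real.cot (π * p.2 / L))) with hQ
  set μa := volume.restrict (Ioo a (L / 2)) with hμa
  set ν := volume.restrict (Ioo 0 (L / 2)) with hν
  have hlam : (1 : ℝ) < 1 + δ := by linarith
  have hBm : MeasurableSet B := measurableSet_band L (1 + δ)
  have hQi : IntegrableOn Q Bᶜ (μa.prod ν) := integrableOn_offband_dx hL ha hδ hw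
  have hsq : ∀ᵐ p ∂(μa.prod ν), p ∈ Ioo a (L / 2) ×ˢ Ioo 0 (L / 2) := by
    rw [hμa, hν, Measure.prod_restrict]
    exact ae_restrict_mem (measurableSet_Ioo.prod measurableSet_Ioo)
  have hY : MeasurableSet {p : ℝ × ℝ | p.2 ≤ a} := measurable_snd measurableSet_Iic
  rw [← integral_add_compl hY hQi]
  have part1 : ∫ p in {p : ℝ × ℝ | p.2 ≤ a}, Q p ∂((μa.prod ν).restrict Bᶜ) ≤ 0 := by
    refine integral_nonpos_of_ae ?_
    filter_upwards [ae_restrict_mem hY, ae_restrict_of_ae (ae_restrict_of_ae hsq)] with p hpY hpS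
    obtain ⟨hx, hy⟩ := mem_prod.1 hpS
    have hyx : p.2 < p.1 := lt_of_le_of_lt hpY hx.1
    have hG : hlKernelDx L p.1 p.2 ≤ 0 :=
      hlKernelDx_nonpos hL ⟨ha.1.trans hx.1, hx.2.le⟩ ⟨hy.1.le, hy.2⟩ hyx
    have hf : 0 ≤ w p.2 * Real.cot (π * p.2 / L) := mul_cot_nonneg₇ hL hnn ⟨hy.1.le, hy.2.le⟩
    have hwx : 0 ≤ w p.1 := hnn p.1 ⟨(ha.1.trans hx.1).le, hx.2.le⟩
    exact mul_nonpos_of_nonneg_of_nonpos hwx (mul_nonpos_of_nonpos_of_nonneg hG hf)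
  have part2 : ∫ p in {p : ℝ × ℝ | p.2 ≤ a}ᶜ, Q p ∂((μa.prod ν).restrict Bᶜ) ≤ 0 := by
    -- move to the symmetric square `(a,½L)²`
    have hmeas : ((μa.prod ν).restrict Bᶜ).restrict {p : ℝ × ℝ | p.2 ≤ a}ᶜ =
        ((volume.restrict (Ioo a (L / 2))).prod (volume.restrict (Ioo a (L / 2)))).restrict Bᶜ := by
      rw [Measure.restrict_restrict hY.compl, inter_comm, ← Measure.restrict_restrict hBm.compl,
        hμa, hν, prod_restrict_upper ha.1]
    rw [hmeas]
    set ρ := (volume.restrict (Ioo a (L / 2))).prod (volume.restrict (Ioo a (L / 2))) with hρ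
    have hsq' : ∀ᵐ p ∂ρ, p ∈ Ioo a (L / 2) ×ˢ Ioo a (L / 2) := by
      rw [hρ, Measure.prod_restrict]
      exact ae_restrict_mem (measurableSet_Ioo.prod measurableSet_Ioo)
    -- integrability on `ρ.restrict Bᶜ` (a smaller measure than `(μa.prod ν).restrict Bᶜ`)
    have hle : ρ.restrict Bᶜ ≤ (μa.prod ν).restrict Bᶜ := by
      rw [← hmeas]
      exact Measure.restrict_le_self
    have hQρ : IntegrableOn Q Bᶜ ρ := by
      rw [IntegrableOn] at hQi ⊢
      exact hQi.mono_measure hle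
    -- the swap
    have hsymm : ∀ p : ℝ × ℝ, p.swap ∈ B ↔ p ∈ B := by
      intro p
      simp only [hB, mem_setOf_eq, Prod.fst_swap, Prod.snd_swap]
      exact ⟨fun h => ⟨⟨h.1.2, h.1.1⟩, ⟨h.2.2, h.2.1⟩⟩, fun h => ⟨⟨h.1.2, h.1.1⟩, ⟨h.2.2, h.2.1⟩⟩⟩
    have hind : ∀ p : ℝ × ℝ, Bᶜ.indicator Q p.swap = Bᶜ.indicator (fun q => Q q.swap) p := by
      intro p
      by_cases hp : p ∈ Bᶜ
      · have hp' : p.swap ∈ Bᶜ := fun h => hp ((hsymm p).1 h)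
        rw [indicator_of_mem hp', indicator_of_mem hp]
      · have hp' : p.swap ∉ Bᶜ := fun h => hp (fun h' => h ((hsymm p).2 h'))
        rw [indicator_of_notMem hp', indicator_of_notMem hp]
    have hQρ' : Integrable (Bᶜ.indicator Q) ρ := hQρ.integrable_indicator hBm.compl
    have hswapI : Integrable (Bᶜ.indicator fun q => Q q.swap) ρ := by
      have h := hQρ'.swap
      refine h.congr (Eventually.of_forall fun p => ?_)
      simp only [Function.comp_apply]
      exact hind p
    have hQρs : IntegrableOn (fun q => Q q.swap) Bᶜ ρ :=
      (integrable_indicator_iff hBm.compl).1 hswapI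
    have hswap : ∫ p in Bᶜ, Q p ∂ρ = ∫ p in Bᶜ, Q p.swap ∂ρ := by
      rw [← MeasureTheory.integral_indicator hBm.compl, ← MeasureTheory.integral_indicator hBm.compl,
        ← integral_prod_swap (Bᶜ.indicator Q)]
      exact integral_congr_ae (Eventually.of_forall hind)
    -- `Q + Q∘swap = ω(x)ω(y)T(x,y) ≤ 0` off the diagonal
    have hsum : ∫ p in Bᶜ, (Q p + Q p.swap) ∂ρ ≤ 0 := by
      refine integral_nonpos_of_ae ?_
      filter_upwards [ae_restrict_mem hBm.compl, ae_restrict_of_ae hsq'] with p hpB hpS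
      obtain ⟨hx, hy⟩ := mem_prod.1 hpS
      have hx0 : p.1 ∈ Ioo 0 (L / 2) := ⟨ha.1.trans hx.1, hx.2⟩
      have hy0 : p.2 ∈ Ioo 0 (L / 2) := ⟨ha.1.trans hy.1, hy.2⟩
      have hne : p.1 ≠ p.2 := offband_ne hL hlam hx0 hy0 hpB
      have hT := hlSymKernel_nonpos hL hx0 hy0 hne
      have hww : 0 ≤ w p.1 * w p.2 :=
        mul_nonneg (hnn p.1 ⟨hx0.1.le, hx0.2.le⟩) (hnn p.2 ⟨hy0.1.le, hy0.2.le⟩)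
      have e : Q p + Q p.swap = w p.1 * w p.2 * hlSymKernel L p.1 p.2 := by
        simp only [hQ, Prod.fst_swap, Prod.snd_swap, hlSymKernel]
        ring
      rw [e]
      exact mul_nonpos_of_nonneg_of_nonpos hww hT
    rw [integral_add hQρ hQρs, ← hswap] at hsum
    linarith
  linarith

/-! ### §6 Fubini off the band: `∫∫_{off} ω′Kωcot = ∫ ωcot·[boundary terms] dy − ∫∫_{off} ωGωcot` -/

/-- Almost every real `y` differs from `a`. [folklore] -/
private theorem ae_ne₇ (a : ℝ) : ∀ᵐ y ∂(volume : Measure ℝ), y ≠ a := by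
  rw [ae_iff]
  simp

/-- **The off-band identity after the per-`y` integration by parts and Fubini**: with
`c₁(y) = max(a,x₋(y))`, `c₂(y) = max(a,x₊(y))`, the function
`y ↦ ω(y)cot(μy)[ω(c₁)K(c₁,y) − ω(a)K(a,y) − ω(c₂)K(c₂,y)]` is integrable on `(0,½L)` and
`∫∫_{off} ω′(x)K(x,y)ω(y)cot(μy) = ∫₀^{L/2} ω(y)cot(μy)[…]dy − ∫∫_{off} ω(x)G(x,y)ω(y)cot(μy)`.
[cite: ChoiHouKiselevLuoSverakYao2017, §4 proof of Lemma 7, p. 12 (integration by parts; I₂ = −(1/π)∫∫ωωcot G)] -/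
theorem setIntegral_offband_deriv_eq {L a δ : ℝ} (hL : 0 < L) (ha : a ∈ Ioo 0 (L / 2)) (hδ : 0 < δ)
    {w : ℝ → ℝ} (hw : ContDiff ℝ 1 w) (hodd : ∀ y, w (-y) = -w y) (hper : Function.Periodic w L)
    (hnn : ∀ y ∈ Icc 0 (L / 2), 0 ≤ w y) :
    Integrable (fun y => w y * Real.cot (π * y / L) *
        (w (max a (L / π * Real.arctan (Real.tan (π * y / L) / (1 + δ)))) *
            hlKernel L (max a (L / π * Real.arctan (Real.tan (π * y / L) / (1 + δ)))) y -
          w a * hlKernel L a y -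
          w (max a (L / π * Real.arctan ((1 + δ) * Real.tan (π * y / L)))) *
            hlKernel L (max a (L / π * Real.arctan ((1 + δ) * Real.tan (π * y / L)))) y))
      (volume.restrict (Ioo 0 (L / 2))) ∧
    ∫ p in {p : ℝ × ℝ | (p.1 ∈ Ioo 0 (L / 2) ∧ p.2 ∈ Ioo 0 (L / 2)) ∧
        (Real.tan (π * p.1 / L) < (1 + δ) * Real.tan (π * p.2 / L) ∧
          Real.tan (π * p.2 / L) < (1 + δ) * Real.tan (π * p.1 / L))}ᶜ,
        deriv w p.1 * (hlKernel L p.1 p.2 * (w p.2 * Real.cot (π * p.2 / L)))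
      ∂((volume.restrict (Ioo a (L / 2))).prod (volume.restrict (Ioo 0 (L / 2)))) =
      (∫ y in Ioo 0 (L / 2), w y * Real.cot (π * y / L) *
        (w (max a (L / π * Real.arctan (Real.tan (π * y / L) / (1 + δ)))) *
            hlKernel L (max a (L / π * Real.arctan (Real.tan (π * y / L) / (1 + δ)))) y -
          w a * hlKernel L a y -
          w (max a (L / π * Real.arctan ((1 + δ) * Real.tan (π * y / L)))) *
            hlKernel L (max a (L / π * Real.arctan ((1 + δ) * Real.tan (π * y / L)))) y)) -
      ∫ p in {p : ℝ × ℝ | (p.1 ∈ Ioo 0 (L / 2) ∧ p.2 ∈ Ioo 0 (L / 2)) ∧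
          (Real.tan (π * p.1 / L) < (1 + δ) * Real.tan (π * p.2 / L) ∧
            Real.tan (π * p.2 / L) < (1 + δ) * Real.tan (π * p.1 / L))}ᶜ,
          w p.1 * (hlKernelDx L p.1 p.2 * (w p.2 * Real.cot (π * p.2 / L)))
        ∂((volume.restrict (Ioo a (L / 2))).prod (volume.restrict (Ioo 0 (L / 2)))) := by
  set B : Set (ℝ × ℝ) := {p : ℝ × ℝ | (p.1 ∈ Ioo 0 (L / 2) ∧ p.2 ∈ Ioo 0 (L / 2)) ∧
    (Real.tan (π * p.1 / L) < (1 + δ) * Real.tan (π * p.2 / L) ∧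
      Real.tan (π * p.2 / L) < (1 + δ) * Real.tan (π * p.1 / L))} with hB
  set F : ℝ × ℝ → ℝ := fun p =>
    deriv w p.1 * (hlKernel L p.1 p.2 * (w p.2 * Real.cot (π * p.2 / L))) with hF
  set Q : ℝ × ℝ → ℝ := fun p =>
    w p.1 * (hlKernelDx L p.1 p.2 * (w p.2 * Real.cot (π * p.2 / L))) with hQ
  set μa := volume.restrict (Ioo a (L / 2)) with hμa
  set ν := volume.restrict (Ioo 0 (L / 2)) with hν
  have hlam : (1 : ℝ) < 1 + δ := by linarith
  have hBm : MeasurableSet B := measurableSet_band L (1 + δ)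
  have hw0H := odd_periodic_zero_half hodd hper
  have hFi : Integrable (Bᶜ.indicator F) (μa.prod ν) :=
    (integrable_kernel_prod hL ha hw hodd hper hnn).indicator hBm.compl
  have hQi : Integrable (Bᶜ.indicator Q) (μa.prod ν) :=
    (integrableOn_offband_dx hL ha hδ hw).integrable_indicator hBm.compl
  have hA : Integrable (fun y => ∫ x, Bᶜ.indicator F (x, y) ∂μa) ν := hFi.integral_prod_right
  have hBq : Integrable (fun y => ∫ x, Bᶜ.indicator Q (x, y) ∂μa) ν := hQi.integral_prod_right
  have hAe : ∫ p in Bᶜ, F p ∂(μa.prod ν) = ∫ y, ∫ x, Bᶜ.indicator F (x, y) ∂μa ∂ν := by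
    rw [← MeasureTheory.integral_indicator hBm.compl, integral_prod_symm _ hFi]
  have hBe : ∫ p in Bᶜ, Q p ∂(μa.prod ν) = ∫ y, ∫ x, Bᶜ.indicator Q (x, y) ∂μa ∂ν := by
    rw [← MeasureTheory.integral_indicator hBm.compl, integral_prod_symm _ hQi]
  have hae : ∀ᵐ y ∂ν, ∫ x, Bᶜ.indicator F (x, y) ∂μa =
      w y * Real.cot (π * y / L) *
        (w (max a (L / π * Real.arctan (Real.tan (π * y / L) / (1 + δ)))) *
            hlKernel L (max a (L / π * Real.arctan (Real.tan (π * y / L) / (1 + δ)))) y -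
          w a * hlKernel L a y -
          w (max a (L / π * Real.arctan ((1 + δ) * Real.tan (π * y / L)))) *
            hlKernel L (max a (L / π * Real.arctan ((1 + δ) * Real.tan (π * y / L)))) y) -
      ∫ x, Bᶜ.indicator Q (x, y) ∂μa := by
    filter_upwards [ae_restrict_mem measurableSet_Ioo, ae_restrict_of_ae (ae_ne₇ a)] with y hy hya
    exact inner_offband_eq hL hlam ha hy hya hw hw0H.2
  have hfD : Integrable (fun y => w y * Real.cot (π * y / L) *
      (w (max a (L / π * Real.arctan (Real.tan (π * y / L) / (1 + δ)))) *
          hlKernel L (max a (L / π * Real.arctan (Real.tan (π * y / L) / (1 + δ)))) y -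
        w a * hlKernel L a y -
        w (max a (L / π * Real.arctan ((1 + δ) * Real.tan (π * y / L)))) *
          hlKernel L (max a (L / π * Real.arctan ((1 + δ) * Real.tan (π * y / L)))) y)) ν := by
    refine (hA.add hBq).congr ?_
    filter_upwards [hae] with y hy
    rw [Pi.add_apply, hy]
    ring
  refine ⟨hfD, ?_⟩
  rw [hAe, integral_congr_ae hae, integral_sub hfD hBq, hBe]

/-! ### §7 The band shrinks to the (null) diagonal: `∫∫_{band} ω′Kωcot → 0` -/

/-- **The band integral vanishes in the limit**: along any decreasing sequence `δₙ ↓ 0` the bands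
`B_{1+δₙ}` decrease to a subset of the diagonal, which is null for the product Lebesgue measure, so
`∫∫_{B_{1+δₙ}} ω′(x)K(x,y)ω(y)cot(μy) → 0` (absolute continuity of the integral).
[cite: ChoiHouKiselevLuoSverakYao2017, §4 proof of Lemma 7, p. 12 (the principal value behind I₂)] -/
theorem tendsto_band_integral {L a : ℝ} (hL : 0 < L) (ha : a ∈ Ioo 0 (L / 2)) {w : ℝ → ℝ}
    (hw : ContDiff ℝ 1 w) (hodd : ∀ y, w (-y) = -w y) (hper : Function.Periodic w L)
    (hnn : ∀ y ∈ Icc 0 (L / 2), 0 ≤ w y) {δs : ℕ → ℝ}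
    (hanti : Antitone δs) (hlim : Tendsto δs atTop (𝓝 0)) :
    Tendsto (fun n => ∫ p in {p : ℝ × ℝ | (p.1 ∈ Ioo 0 (L / 2) ∧ p.2 ∈ Ioo 0 (L / 2)) ∧
        (Real.tan (π * p.1 / L) < (1 + δs n) * Real.tan (π * p.2 / L) ∧
          Real.tan (π * p.2 / L) < (1 + δs n) * Real.tan (π * p.1 / L))},
        deriv w p.1 * (hlKernel L p.1 p.2 * (w p.2 * Real.cot (π * p.2 / L)))
      ∂((volume.restrict (Ioo a (L / 2))).prod (volume.restrict (Ioo 0 (L / 2))))) atTop (𝓝 0) := by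
  set μa := volume.restrict (Ioo a (L / 2)) with hμa
  set ν := volume.restrict (Ioo 0 (L / 2)) with hν
  set Bn : ℕ → Set (ℝ × ℝ) := fun n => {p : ℝ × ℝ | (p.1 ∈ Ioo 0 (L / 2) ∧ p.2 ∈ Ioo 0 (L / 2)) ∧
    (Real.tan (π * p.1 / L) < (1 + δs n) * Real.tan (π * p.2 / L) ∧
      Real.tan (π * p.2 / L) < (1 + δs n) * Real.tan (π * p.1 / L))} with hBn
  have hFi := integrable_kernel_prod hL ha hw hodd hper hnn
  have hBm : ∀ n, MeasurableSet (Bn n) := fun n => measurableSet_band L (1 + δs n)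
  have hBanti : Antitone Bn := by
    intro m n hmn p hp
    obtain ⟨⟨hx, hy⟩, h1, h2⟩ := hp
    have hl : 1 + δs n ≤ 1 + δs m := by linarith [hanti hmn]
    have htx := tan_phase_pos_of_mem_Ioo hL hx
    have hty := tan_phase_pos_of_mem_Ioo hL hy
    exact ⟨⟨hx, hy⟩, h1.trans_le (mul_le_mul_of_nonneg_right hl hty.le),
      h2.trans_le (mul_le_mul_of_nonneg_right hl htx.le)⟩
  have hmeas := tendsto_measure_iInter_atTop (μ := μa.prod ν)
    (fun n => (hBm n).nullMeasurableSet) hBanti ⟨0, measure_ne_top _ _⟩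
  have hnull : (μa.prod ν) (⋂ n, Bn n) = 0 := by
    have hsub : (⋂ n, Bn n) ⊆ {p : ℝ × ℝ | p.1 = p.2} := by
      intro p hp
      rw [mem_iInter] at hp
      obtain ⟨⟨hx, hy⟩, -, -⟩ := hp 0
      have hl1 : Tendsto (fun n => (1 + δs n) * Real.tan (π * p.2 / L)) atTop
          (𝓝 ((1 + 0) * Real.tan (π * p.2 / L))) :=
        (tendsto_const_nhds.add hlim).mul tendsto_const_nhds
      have hl2 : Tendsto (fun n => (1 + δs n) * Real.tan (π * p.1 / L)) atTop
          (𝓝 ((1 + 0) * Real.tan (π * p.1 / L))) :=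
        (tendsto_const_nhds.add hlim).mul tendsto_const_nhds
      rw [add_zero, one_mul] at hl1 hl2
      have h1 : Real.tan (π * p.1 / L) ≤ Real.tan (π * p.2 / L) :=
        ge_of_tendsto' hl1 fun n => (hp n).2.1.le
      have h2 : Real.tan (π * p.2 / L) ≤ Real.tan (π * p.1 / L) :=
        ge_of_tendsto' hl2 fun n => (hp n).2.2.le
      exact tan_phase_inj hL hx hy (le_antisymm h1 h2)
    refine measure_mono_null hsub ?_
    have hD : MeasurableSet {p : ℝ × ℝ | p.1 = p.2} :=
      (isClosed_eq continuous_fst continuous_snd).measurableSet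
    rw [Measure.measure_prod_null hD]
    refine Eventually.of_forall fun x => ?_
    have e : Prod.mk x ⁻¹' {p : ℝ × ℝ | p.1 = p.2} = {x} := by
      ext y
      simp only [mem_preimage, mem_setOf_eq, mem_singleton_iff, eq_comm]
    simp only [Pi.zero_apply, e, hν, Measure.restrict_apply (measurableSet_singleton x)]
    exact measure_mono_null inter_subset_left (measure_singleton x)
  rw [hnull] at hmeas
  exact hFi.tendsto_setIntegral_nhds_zero hmeas

/-! ### §8 The boundary terms of the truncated integration by parts vanish as `δ → 0` -/

/-- Regime `y ≤ x₋(a)`: both clipped truncation points equal `a`. [folklore] -/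
private theorem cuts_below {L a δ y : ℝ} (hL : 0 < L) (hδ : 0 < δ) (ha : a ∈ Ioo 0 (L / 2))
    (hy : y ∈ Ioo 0 (L / 2)) (hle : y ≤ L / π * Real.arctan (Real.tan (π * a / L) / (1 + δ))) :
    max a (L / π * Real.arctan (Real.tan (π * y / L) / (1 + δ))) = a ∧
      max a (L / π * Real.arctan ((1 + δ) * Real.tan (π * y / L))) = a := by
  have hlam : (1 : ℝ) < 1 + δ := by linarith
  obtain ⟨⟨hma, htma, -⟩, -⟩ := cut_points hL hlam ha
  obtain ⟨⟨hmy, -, hmyy⟩, ⟨hpy, htpy, hypy⟩⟩ := cut_points hL hlam hy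
  have h1 : Real.tan (π * y / L) ≤ Real.tan (π * a / L) / (1 + δ) := by
    rw [← htma]; exact (tan_phase_le_iff hL hy hma).2 hle
  have h2 : L / π * Real.arctan ((1 + δ) * Real.tan (π * y / L)) ≤ a := by
    apply (tan_phase_le_iff hL hpy ha).1
    rw [htpy]
    have := mul_le_mul_of_nonneg_left h1 (by linarith : (0 : ℝ) ≤ 1 + δ)
    rwa [mul_div_cancel₀ _ (by linarith : (1 + δ) ≠ 0)] at this
  exact ⟨max_eq_left ((hmyy.trans hypy).le.trans h2), max_eq_left h2⟩

/-- Regime `x₊(a) ≤ y`: no clipping. [folklore] -/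
private theorem cuts_above {L a δ y : ℝ} (hL : 0 < L) (hδ : 0 < δ) (ha : a ∈ Ioo 0 (L / 2))
    (hy : y ∈ Ioo 0 (L / 2)) (hge : L / π * Real.arctan ((1 + δ) * Real.tan (π * a / L)) ≤ y) :
    max a (L / π * Real.arctan (Real.tan (π * y / L) / (1 + δ))) =
        L / π * Real.arctan (Real.tan (π * y / L) / (1 + δ)) ∧
      max a (L / π * Real.arctan ((1 + δ) * Real.tan (π * y / L))) =
        L / π * Real.arctan ((1 + δ) * Real.tan (π * y / L)) := by
  have hlam : (1 : ℝ) < 1 + δ := by linarith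
  obtain ⟨-, ⟨hpa, htpa, -⟩⟩ := cut_points hL hlam ha
  obtain ⟨⟨hmy, htmy, hmyy⟩, ⟨hpy, -, hypy⟩⟩ := cut_points hL hlam hy
  have h1 : (1 + δ) * Real.tan (π * a / L) ≤ Real.tan (π * y / L) := by
    rw [← htpa]; exact (tan_phase_le_iff hL hpa hy).2 hge
  have h2 : a ≤ L / π * Real.arctan (Real.tan (π * y / L) / (1 + δ)) := by
    apply (tan_phase_le_iff hL ha hmy).1
    rw [htmy, le_div_iff₀ (by linarith : (0 : ℝ) < 1 + δ)]
    linarith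
  exact ⟨max_eq_right h2, max_eq_right (h2.trans (hmyy.trans hypy).le)⟩

/-- Regime `x₋(a) < y < x₊(a)`: only the lower point is clipped. [folklore] -/
private theorem cuts_middle {L a δ y : ℝ} (hL : 0 < L) (hδ : 0 < δ) (ha : a ∈ Ioo 0 (L / 2))
    (hy : y ∈ Ioo 0 (L / 2))
    (hI : y ∈ Ioo (L / π * Real.arctan (Real.tan (π * a / L) / (1 + δ)))
      (L / π * Real.arctan ((1 + δ) * Real.tan (π * a / L)))) :
    max a (L / π * Real.arctan (Real.tan (π * y / L) / (1 + δ))) = a ∧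
      max a (L / π * Real.arctan ((1 + δ) * Real.tan (π * y / L))) =
        L / π * Real.arctan ((1 + δ) * Real.tan (π * y / L)) := by
  have hlam : (1 : ℝ) < 1 + δ := by linarith
  have hl0 : (0 : ℝ) < 1 + δ := by linarith
  obtain ⟨⟨hma, htma, -⟩, ⟨hpa, htpa, -⟩⟩ := cut_points hL hlam ha
  obtain ⟨⟨hmy, htmy, -⟩, ⟨hpy, htpy, -⟩⟩ := cut_points hL hlam hy
  have h1 : Real.tan (π * a / L) / (1 + δ) < Real.tan (π * y / L) := by
    rw [← htma]; exact (tan_phase_lt_iff hL hma hy).2 hI.1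
  have h2 : Real.tan (π * y / L) < (1 + δ) * Real.tan (π * a / L) := by
    rw [← htpa]; exact (tan_phase_lt_iff hL hy hpa).2 hI.2
  have h3 : L / π * Real.arctan (Real.tan (π * y / L) / (1 + δ)) < a := by
    apply (tan_phase_lt_iff hL hmy ha).1
    rw [htmy, div_lt_iff₀ hl0]
    linarith
  have h4 : a < L / π * Real.arctan ((1 + δ) * Real.tan (π * y / L)) := by
    apply (tan_phase_lt_iff hL ha hpy).1
    rw [htpy]
    have := mul_lt_mul_of_pos_left h1 hl0
    rwa [mul_div_cancel₀ _ hl0.ne'] at this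
  exact ⟨max_eq_left h3.le, max_eq_right h4.le⟩

/-- `1 − (1+δ)⁻² ∈ [0, 2δ]` for `δ > 0`. [folklore] -/
private theorem one_sub_inv_sq_le {δ : ℝ} (hδ : 0 < δ) :
    0 ≤ 1 - 1 / (1 + δ) ^ 2 ∧ 1 - 1 / (1 + δ) ^ 2 ≤ 2 * δ := by
  have h1 : (1 : ℝ) < (1 + δ) ^ 2 := by nlinarith
  have h0 : (0 : ℝ) < (1 + δ) ^ 2 := by positivity
  constructor
  · rw [sub_nonneg, div_le_one h0]; exact h1.le
  · rw [sub_le_iff_le_add, ← sub_le_iff_le_add', le_div_iff₀ h0]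
    nlinarith [pow_pos hδ 2, pow_pos hδ 3]

/-- **The boundary bracket above the band is `O(δ)`**: for `x₊(a) ≤ y < ½L`,
`|ω(x₋(y)) − ω(x₊(y))/(1+δ)²| ≤ δ·(M′·2L/π + 2M)` (`|ω′| ≤ M′`, `|ω| ≤ M` on `[0,½L]`,
`x₊ − x₋ ≤ (2L/π)δ`). [cite: ChoiHouKiselevLuoSverakYao2017, §4 proof of Lemma 7, p. 12 (integration by parts; boundary terms)] -/
theorem abs_boundary_bracket_le {L δ y M M' : ℝ} (hL : 0 < L) (hδ : 0 < δ) (hδ1 : δ ≤ 1)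
    (hy : y ∈ Ioo 0 (L / 2)) {w : ℝ → ℝ} (hw : ContDiff ℝ 1 w)
    (hM : ∀ z ∈ Icc 0 (L / 2), |w z| ≤ M) (hM' : ∀ z ∈ Icc 0 (L / 2), |deriv w z| ≤ M') :
    |w (L / π * Real.arctan (Real.tan (π * y / L) / (1 + δ))) -
        w (L / π * Real.arctan ((1 + δ) * Real.tan (π * y / L))) / (1 + δ) ^ 2| ≤
      δ * (M' * (2 * L / π) + 2 * M) := by
  have hlam : (1 : ℝ) < 1 + δ := by linarith
  obtain ⟨⟨hm, htm, -⟩, ⟨hp, htp, -⟩⟩ := cut_points hL hlam hy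
  set xm := L / π * Real.arctan (Real.tan (π * y / L) / (1 + δ)) with hxm
  set xp := L / π * Real.arctan ((1 + δ) * Real.tan (π * y / L)) with hxp
  have hdist : xp - xm ≤ 2 * L / π * δ :=
    sub_le_of_tan_eq hL hδ hδ1 (tan_phase_pos_of_mem_Ioo hL hy).le hm hp htm htp
  have hmI : xm ∈ Icc 0 (L / 2) := ⟨hm.1.le, hm.2.le⟩
  have hpI : xp ∈ Icc 0 (L / 2) := ⟨hp.1.le, hp.2.le⟩
  have hM'0 : 0 ≤ M' := (abs_nonneg _).trans (hM' xm hmI)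
  have hlip : ‖w xp - w xm‖ ≤ M' * ‖xp - xm‖ :=
    (convex_Icc 0 (L / 2)).norm_image_sub_le_of_norm_deriv_le
      (fun z _ => (hw.differentiable (by norm_num)).differentiableAt)
      (fun z hz => by rw [Real.norm_eq_abs]; exact hM' z hz) hmI hpI
  rw [Real.norm_eq_abs, Real.norm_eq_abs, abs_of_nonneg (by linarith [(cut_points hL hlam hy).1.2.2,
    (cut_points hL hlam hy).2.2.2] : 0 ≤ xp - xm)] at hlip
  obtain ⟨hq0, hq2⟩ := one_sub_inv_sq_le hδ
  have e : w xm - w xp / (1 + δ) ^ 2 = (w xm - w xp) + w xp * (1 - 1 / (1 + δ) ^ 2) := by ring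
  rw [e]
  calc |(w xm - w xp) + w xp * (1 - 1 / (1 + δ) ^ 2)|
      ≤ |w xm - w xp| + |w xp * (1 - 1 / (1 + δ) ^ 2)| := abs_add_le _ _
    _ = |w xp - w xm| + |w xp| * (1 - 1 / (1 + δ) ^ 2) := by
        rw [abs_sub_comm, abs_mul, abs_of_nonneg hq0]
    _ ≤ M' * (2 * L / π * δ) + M * (2 * δ) := by
        refine add_le_add (hlip.trans (mul_le_mul_of_nonneg_left hdist hM'0)) ?_
        exact mul_le_mul (hM xp hpI) hq2 hq0 ((abs_nonneg _).trans (hM xp hpI))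
    _ = δ * (M' * (2 * L / π) + 2 * M) := by ring

/-- `δ·φ(1+δ) → 0` along `δₙ → 0⁺` (`0 ≤ δφ(1+δ) ≤ 2(1+δ)√(δ(2+δ))`). [cite: ChoiHouKiselevLuoSverakYao2017, §4 proof of Lemma 7, p. 12 (integration by parts; boundary terms)] -/
theorem tendsto_mul_hlKernelFn {δs : ℕ → ℝ} (hpos : ∀ n, 0 < δs n)
    (hlim : Tendsto δs atTop (𝓝 0)) :
    Tendsto (fun n => δs n * hlKernelFn (1 + δs n)) atTop (𝓝 0) := by
  have hg : Continuous fun x : ℝ => 2 * (1 + x) * Real.sqrt (x * (2 + x)) := by fun_prop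
  have hg0 : Tendsto (fun n => 2 * (1 + δs n) * Real.sqrt (δs n * (2 + δs n))) atTop (𝓝 0) := by
    have h := (hg.tendsto 0).comp hlim
    simp only [Function.comp_def, zero_mul, Real.sqrt_zero, mul_zero] at h
    exact h
  refine squeeze_zero (fun n => mul_nonneg (hpos n).le (hlKernelFn_one_add_nonneg (hpos n)))
    (fun n => mul_hlKernelFn_one_add_le (hpos n)) hg0

/-- **The boundary terms of the truncated integration by parts vanish as `δ → 0`.** With
`Φ(a) = ∫₀^{L/2} K(a,y)ω(y)cot(μy)dy` and the per-`y` boundary bracket of `inner_offband_eq`,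
`ω(a)Φ(a) + ∫₀^{L/2} ωcot·[ω(c₁)K(c₁,y) − ω(a)K(a,y) − ω(c₂)K(c₂,y)] dy → 0` along `δₙ → 0⁺`:
for `y ≤ x₋(a)` the bracket is `0`; for `y ≥ x₊(a)` it is `φ(1+δ)[ω(x₋(y)) − ω(x₊(y))/(1+δ)²] =
O(δφ(1+δ))`; on the window `(x₋(a), x₊(a))` of length `≤ (2L/π)δ` it is `ω(a)K(a,y) −
ω(x₊(y))φ(1+δ)/(1+δ)²`, whose integral is small by absolute continuity and `δφ(1+δ) → 0`.
[cite: ChoiHouKiselevLuoSverakYao2017, §4 proof of Lemma 7, p. 12 (integration by parts; boundary terms)] -/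
theorem tendsto_boundary {L a : ℝ} (hL : 0 < L) (ha : a ∈ Ioo 0 (L / 2)) {w : ℝ → ℝ}
    (hw : ContDiff ℝ 1 w) (hodd : ∀ y, w (-y) = -w y) (hper : Function.Periodic w L)
    (hnn : ∀ y ∈ Icc 0 (L / 2), 0 ≤ w y) {δs : ℕ → ℝ} (hpos : ∀ n, 0 < δs n)
    (hle1 : ∀ n, δs n ≤ 1) (hlim : Tendsto δs atTop (𝓝 0)) :
    Tendsto (fun n => w a * (∫ y in (0 : ℝ)..L / 2, hlKernel L a y * (w y * Real.cot (π * y / L))) +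
      ∫ y in Ioo 0 (L / 2), w y * Real.cot (π * y / L) *
        (w (max a (L / π * Real.arctan (Real.tan (π * y / L) / (1 + δs n)))) *
            hlKernel L (max a (L / π * Real.arctan (Real.tan (π * y / L) / (1 + δs n)))) y -
          w a * hlKernel L a y -
          w (max a (L / π * Real.arctan ((1 + δs n) * Real.tan (π * y / L)))) *
            hlKernel L (max a (L / π * Real.arctan ((1 + δs n) * Real.tan (π * y / L)))) y)) atTop (𝓝 0) := by
  set ν := volume.restrict (Ioo 0 (L / 2)) with hν
  have hw0 := (odd_periodic_zero_half hodd hper).1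
  obtain ⟨M, hM0, hM⟩ := exists_bound_Icc hw.continuous L
  obtain ⟨M', hM'0, hM'⟩ := exists_bound_Icc (hw.continuous_deriv le_rfl) L
  have hfb : ∀ y ∈ Icc 0 (L / 2), |w y * Real.cot (π * y / L)| ≤ M' * (L / π) :=
    fun y hy => abs_mul_cot_phase_le hL hw hw0 hM' hy
  set Cf := M' * (L / π) with hCf
  have hCf0 : 0 ≤ Cf := by positivity
  have hlam : ∀ n, (1 : ℝ) < 1 + δs n := fun n => by linarith [hpos n]
  have hta : 0 < Real.tan (π * a / L) := tan_phase_pos_of_mem_Ioo hL ha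
  -- `K(a,·)ωcot` is integrable on `(0, ½L)`
  have hL2 : (0 : ℝ) ≤ L / 2 := by linarith [ha.2]
  have hKf : Integrable (fun y => hlKernel L a y * (w y * Real.cot (π * y / L))) ν := by
    have hint := intervalIntegrable_kernelIntegrand hL hw.continuous ha
    rw [intervalIntegrable_iff_integrableOn_Ioc_of_le hL2] at hint
    exact hint.mono_set Ioo_subset_Ioc_self
  -- the window `I n = (x₋(a), x₊(a))` and the full integrand `g n`
  set I : ℕ → Set ℝ := fun n => Ioo (L / π * Real.arctan (Real.tan (π * a / L) / (1 + δs n))) (L / π * Real.arctan ((1 + δs n) * Real.tan (π * a / L))) with hI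
  set g : ℕ → ℝ → ℝ := fun n y => w a * (hlKernel L a y * (w y * Real.cot (π * y / L))) +
      w y * Real.cot (π * y / L) *
        (w (max a (L / π * Real.arctan (Real.tan (π * y / L) / (1 + δs n)))) *
            hlKernel L (max a (L / π * Real.arctan (Real.tan (π * y / L) / (1 + δs n)))) y -
          w a * hlKernel L a y -
          w (max a (L / π * Real.arctan ((1 + δs n) * Real.tan (π * y / L)))) *
            hlKernel L (max a (L / π * Real.arctan ((1 + δs n) * Real.tan (π * y / L)))) y) with hg
  have hgi : ∀ n, Integrable (g n) ν := fun n =>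
    (hKf.const_mul (w a)).add (setIntegral_offband_deriv_eq hL ha (hpos n) hw hodd hper hnn).1
  -- Step 1: the quantity is `∫ g n`
  have hE : ∀ n, w a * (∫ y in (0 : ℝ)..L / 2, hlKernel L a y * (w y * Real.cot (π * y / L))) +
      ∫ y in Ioo 0 (L / 2), w y * Real.cot (π * y / L) *
        (w (max a (L / π * Real.arctan (Real.tan (π * y / L) / (1 + δs n)))) *
            hlKernel L (max a (L / π * Real.arctan (Real.tan (π * y / L) / (1 + δs n)))) y -
          w a * hlKernel L a y -
          w (max a (L / π * Real.arctan ((1 + δs n) * Real.tan (π * y / L)))) *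
            hlKernel L (max a (L / π * Real.arctan ((1 + δs n) * Real.tan (π * y / L)))) y) = ∫ y, g n y ∂ν := by
    intro n
    rw [intervalIntegral.integral_of_le hL2, integral_Ioc_eq_integral_Ioo,
      ← MeasureTheory.integral_const_mul,
      ← integral_add (hKf.const_mul _) (setIntegral_offband_deriv_eq hL ha (hpos n) hw hodd hper hnn).1]
  -- Step 2: split `∫ g n = ω(a)∫_I K(a,·)ωcot + ∫_I (g n − ω(a)K(a,·)ωcot) + ∫_{Iᶜ} g n`
  have hsplit : ∀ n, ∫ y, g n y ∂ν =
      w a * (∫ y in I n, hlKernel L a y * (w y * Real.cot (π * y / L)) ∂ν) +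
        (∫ y in I n, (g n y - w a * (hlKernel L a y * (w y * Real.cot (π * y / L)))) ∂ν) +
        ∫ y in (I n)ᶜ, g n y ∂ν := by
    intro n
    have hIm : MeasurableSet (I n) := measurableSet_Ioo
    rw [← integral_add_compl hIm (hgi n), integral_sub (hgi n).integrableOn
      (hKf.const_mul _).integrableOn, MeasureTheory.integral_const_mul]
    ring
  -- Step 3a: `ω(a)∫_{I n} K(a,·)ωcot → 0` (the window shrinks: `|I n| ≤ (2L/π)δₙ`)
  have hIle : ∀ n, ν (I n) ≤ ENNReal.ofReal (2 * L / π * δs n) := by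
    intro n
    obtain ⟨⟨hma, htma, hmaa⟩, ⟨hpa, htpa, hapa⟩⟩ := cut_points hL (hlam n) ha
    have hdist := sub_le_of_tan_eq hL (hpos n) (hle1 n) hta.le hma hpa htma htpa
    rw [hν, Measure.restrict_apply measurableSet_Ioo]
    refine (measure_mono inter_subset_left).trans ?_
    rw [Real.volume_Ioo]
    exact ENNReal.ofReal_le_ofReal hdist
  have hIν : Tendsto (fun n => ν (I n)) atTop (𝓝 0) := by
    have hup : Tendsto (fun n => ENNReal.ofReal (2 * L / π * δs n)) atTop (𝓝 0) := by
      have h := ENNReal.tendsto_ofReal (hlim.const_mul (2 * L / π))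
      rwa [mul_zero, ENNReal.ofReal_zero] at h
    exact tendsto_of_tendsto_of_tendsto_of_le_of_le tendsto_const_nhds hup (fun _ => bot_le) hIle
  have hT1 : Tendsto (fun n => w a * ∫ y in I n, hlKernel L a y * (w y * Real.cot (π * y / L)) ∂ν)
      atTop (𝓝 0) := by
    have h := (hKf.tendsto_setIntegral_nhds_zero hIν).const_mul (w a)
    rwa [mul_zero] at h
  -- the common small quantity `e n = δₙ φ(1+δₙ) → 0`
  have he := tendsto_mul_hlKernelFn hpos hlim
  have hνI_real : ∀ n, ν.real (I n) ≤ 2 * L / π * δs n := fun n =>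
    ENNReal.toReal_le_of_le_ofReal (by have := hpos n; positivity) (hIle n)
  -- Step 3b: on the window, `g n − ω(a)K(a,·)ωcot = −ωcot·ω(x₊(y))·φ/(1+δ)²`, bounded by `Cf·M·φ`
  have hT2b : ∀ n, ‖∫ y in I n, (g n y - w a * (hlKernel L a y * (w y * Real.cot (π * y / L)))) ∂ν‖ ≤
      Cf * M * (2 * L / π) * (δs n * hlKernelFn (1 + δs n)) := by
    intro n
    obtain ⟨⟨hma, htma, hmaa⟩, ⟨hpa, htpa, hapa⟩⟩ := cut_points hL (hlam n) ha
    have hφ0 : 0 ≤ hlKernelFn (1 + δs n) := hlKernelFn_one_add_nonneg (hpos n)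
    have hpt : ∀ y ∈ I n, ‖g n y - w a * (hlKernel L a y * (w y * Real.cot (π * y / L)))‖ ≤
        Cf * M * hlKernelFn (1 + δs n) := by
      intro y hyI
      have hyI' : y ∈ Ioo (L / π * Real.arctan (Real.tan (π * a / L) / (1 + δs n))) (L / π * Real.arctan ((1 + δs n) * Real.tan (π * a / L))) := hyI
      have hy : y ∈ Ioo 0 (L / 2) := ⟨hma.1.trans hyI'.1, hyI'.2.trans hpa.2⟩
      have hyc : y ∈ Icc 0 (L / 2) := ⟨hy.1.le, hy.2.le⟩
      obtain ⟨-, ⟨hpy, htpy, -⟩⟩ := cut_points hL (hlam n) hy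
      have hty : Real.tan (π * y / L) ≠ 0 := (tan_phase_pos_of_mem_Ioo hL hy).ne'
      obtain ⟨e1, e2⟩ := cuts_middle hL (hpos n) ha hy hyI'
      have hKp := hlKernel_upper_eq (hpos n) hty htpy
      have eg : g n y - w a * (hlKernel L a y * (w y * Real.cot (π * y / L))) =
          -(w y * Real.cot (π * y / L) * w (L / π * Real.arctan ((1 + δs n) * Real.tan (π * y / L))) *
            (hlKernelFn (1 + δs n) / (1 + δs n) ^ 2)) := by
        simp only [hg, e1, e2, hKp]
        ring
      rw [eg, norm_neg, Real.norm_eq_abs, abs_mul, abs_mul,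
        abs_of_nonneg (by positivity : 0 ≤ hlKernelFn (1 + δs n) / (1 + δs n) ^ 2)]
      have hq : hlKernelFn (1 + δs n) / (1 + δs n) ^ 2 ≤ hlKernelFn (1 + δs n) :=
        div_le_self hφ0 (by nlinarith [hpos n])
      have h1 : |w y * Real.cot (π * y / L)| * |w (L / π * Real.arctan ((1 + δs n) * Real.tan (π * y / L)))| ≤ Cf * M :=
        mul_le_mul (hfb y hyc) (hM _ ⟨hpy.1.le, hpy.2.le⟩) (abs_nonneg _) hCf0
      exact mul_le_mul h1 hq (by positivity) (by positivity)
    refine (norm_setIntegral_le_of_norm_le_const (measure_lt_top ν _) hpt).trans ?_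
    calc Cf * M * hlKernelFn (1 + δs n) * ν.real (I n)
        ≤ Cf * M * hlKernelFn (1 + δs n) * (2 * L / π * δs n) :=
          mul_le_mul_of_nonneg_left (hνI_real n) (by positivity)
      _ = Cf * M * (2 * L / π) * (δs n * hlKernelFn (1 + δs n)) := by ring
  have hT2 : Tendsto (fun n => ∫ y in I n,
      (g n y - w a * (hlKernel L a y * (w y * Real.cot (π * y / L)))) ∂ν) atTop (𝓝 0) := by
    refine squeeze_zero_norm hT2b ?_
    have h := he.const_mul (Cf * M * (2 * L / π))
    rwa [mul_zero] at h
  -- Step 3c: off the window, `|g n| ≤ Cf·δφ(1+δ)·(M′·2L/π + 2M)` pointwise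
  have hT3b : ∀ n, ‖∫ y in (I n)ᶜ, g n y ∂ν‖ ≤
      Cf * ((δs n * hlKernelFn (1 + δs n)) * (M' * (2 * L / π) + 2 * M)) * ν.real univ := by
    intro n
    obtain ⟨⟨hma, htma, hmaa⟩, ⟨hpa, htpa, hapa⟩⟩ := cut_points hL (hlam n) ha
    have hφ0 : 0 ≤ hlKernelFn (1 + δs n) := hlKernelFn_one_add_nonneg (hpos n)
    have hε0 : 0 ≤ Cf * ((δs n * hlKernelFn (1 + δs n)) * (M' * (2 * L / π) + 2 * M)) := by
      have := hpos n
      positivity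
    have hae : ∀ᵐ y ∂ν.restrict (I n)ᶜ, ‖g n y‖ ≤
        Cf * ((δs n * hlKernelFn (1 + δs n)) * (M' * (2 * L / π) + 2 * M)) := by
      have hmem : ∀ᵐ y ∂ν, y ∈ Ioo 0 (L / 2) := ae_restrict_mem measurableSet_Ioo
      filter_upwards [ae_restrict_mem (measurableSet_Ioo.compl), ae_restrict_of_ae hmem] with y hyI hy
      have hyI' : y ∉ Ioo (L / π * Real.arctan (Real.tan (π * a / L) / (1 + δs n))) (L / π * Real.arctan ((1 + δs n) * Real.tan (π * a / L))) := hyI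
      have hyc : y ∈ Icc 0 (L / 2) := ⟨hy.1.le, hy.2.le⟩
      have hty : Real.tan (π * y / L) ≠ 0 := (tan_phase_pos_of_mem_Ioo hL hy).ne'
      obtain ⟨⟨hmy, htmy, -⟩, ⟨hpy, htpy, -⟩⟩ := cut_points hL (hlam n) hy
      rw [mem_Ioo, not_and_or, not_lt, not_lt] at hyI'
      rcases hyI' with hbelow | habove
      · obtain ⟨e1, e2⟩ := cuts_below hL (hpos n) ha hy hbelow
        have eg : g n y = 0 := by
          simp only [hg, e1, e2]
          ring
        rw [eg, norm_zero]
        exact hε0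
      · obtain ⟨e1, e2⟩ := cuts_above hL (hpos n) ha hy habove
        have hKm := hlKernel_lower_eq (hpos n) hty htmy
        have hKp := hlKernel_upper_eq (hpos n) hty htpy
        have eg : g n y = w y * Real.cot (π * y / L) * hlKernelFn (1 + δs n) *
            (w (L / π * Real.arctan (Real.tan (π * y / L) / (1 + δs n))) -
              w (L / π * Real.arctan ((1 + δs n) * Real.tan (π * y / L))) / (1 + δs n) ^ 2) := by
          simp only [hg, e1, e2, hKm, hKp]
          ring
        rw [eg, Real.norm_eq_abs, abs_mul, abs_mul, abs_of_nonneg hφ0]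
        have hbr := abs_boundary_bracket_le hL (hpos n) (hle1 n) hy hw hM hM'
        calc |w y * Real.cot (π * y / L)| * hlKernelFn (1 + δs n) *
              |w (L / π * Real.arctan (Real.tan (π * y / L) / (1 + δs n))) -
                w (L / π * Real.arctan ((1 + δs n) * Real.tan (π * y / L))) / (1 + δs n) ^ 2|
            ≤ Cf * hlKernelFn (1 + δs n) * (δs n * (M' * (2 * L / π) + 2 * M)) :=
              mul_le_mul (mul_le_mul_of_nonneg_right (hfb y hyc) hφ0) hbr (abs_nonneg _)
                (by positivity)
          _ = Cf * ((δs n * hlKernelFn (1 + δs n)) * (M' * (2 * L / π) + 2 * M)) := by ring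
    refine (norm_setIntegral_le_of_norm_le_const_ae (measure_lt_top ν _) hae).trans ?_
    exact mul_le_mul_of_nonneg_left (measureReal_mono (subset_univ _)) hε0
  have hT3 : Tendsto (fun n => ∫ y in (I n)ᶜ, g n y ∂ν) atTop (𝓝 0) := by
    refine squeeze_zero_norm hT3b ?_
    have h := ((he.mul_const (M' * (2 * L / π) + 2 * M)).const_mul Cf).mul_const (ν.real univ)
    rwa [zero_mul, mul_zero, zero_mul] at h
  -- assemble
  have hsum := (hT1.add hT2).add hT3
  rw [add_zero, add_zero] at hsum
  refine hsum.congr fun n => ?_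
  rw [hE n, hsplit n]

/-! ### §9 Assembly: `Ψ(a) = ω(a)Φ(a) + ∫ₐ^{L/2} ω′Φ ≥ 0`, then Lemma 7 -/

/-- **`ω(a)Φ(a) + ∫ₐ^{L/2} ω′(x)Φ(x) dx ≥ 0`** for `a ∈ (0,½L)`, `Φ(x) = ∫₀^{L/2}K(x,y)ω(y)cot(μy)dy`:
for every `δ`, `Ψ = [band integral] + [boundary terms] + Σ_δ` with `Σ_δ ≥ 0`
(`setIntegral_offband_dx_nonpos`), and the first two tend to `0` as `δ → 0`.
[cite: ChoiHouKiselevLuoSverakYao2017, §4 proof of Lemma 7, p. 12 (I = I₁ + I₂ ≥ 0)] -/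
theorem boundary_add_integral_nonneg {L a : ℝ} (hL : 0 < L) (ha : a ∈ Ioo 0 (L / 2)) {w : ℝ → ℝ}
    (hw : ContDiff ℝ 1 w) (hodd : ∀ y, w (-y) = -w y) (hper : Function.Periodic w L)
    (hnn : ∀ y ∈ Icc 0 (L / 2), 0 ≤ w y) :
    0 ≤ w a * (∫ y in (0 : ℝ)..L / 2, hlKernel L a y * (w y * Real.cot (π * y / L))) +
      ∫ x in a..L / 2, deriv w x *
        ∫ y in (0 : ℝ)..L / 2, hlKernel L x y * (w y * Real.cot (π * y / L)) := by
  set δs : ℕ → ℝ := fun n => 1 / ((n : ℝ) + 1) with hδs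
  have hpos : ∀ n, 0 < δs n := fun n => by simp only [hδs]; positivity
  have hle1 : ∀ n, δs n ≤ 1 := fun n => by
    simp only [hδs]
    rw [div_le_one (by positivity)]
    linarith [n.cast_nonneg (α := ℝ)]
  have hanti : Antitone δs := fun m n hmn => by
    simp only [hδs]
    exact one_div_le_one_div_of_le (by positivity) (by simpa using hmn)
  have hlim : Tendsto δs atTop (𝓝 0) := tendsto_one_div_add_atTop_nhds_zero_nat
  have hFi := integrable_kernel_prod hL ha hw hodd hper hnn
  rw [← integral_kernel_prod_eq hL ha hw hodd hper hnn]
  have hmain : ∀ n, (w a * (∫ y in (0 : ℝ)..L / 2, hlKernel L a y * (w y * Real.cot (π * y / L))) +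
      ∫ y in Ioo 0 (L / 2), w y * Real.cot (π * y / L) *
        (w (max a (L / π * Real.arctan (Real.tan (π * y / L) / (1 + δs n)))) *
            hlKernel L (max a (L / π * Real.arctan (Real.tan (π * y / L) / (1 + δs n)))) y -
          w a * hlKernel L a y -
          w (max a (L / π * Real.arctan ((1 + δs n) * Real.tan (π * y / L)))) *
            hlKernel L (max a (L / π * Real.arctan ((1 + δs n) * Real.tan (π * y / L)))) y)) +
      (∫ p in {p : ℝ × ℝ | (p.1 ∈ Ioo 0 (L / 2) ∧ p.2 ∈ Ioo 0 (L / 2)) ∧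
        (Real.tan (π * p.1 / L) < (1 + δs n) * Real.tan (π * p.2 / L) ∧
          Real.tan (π * p.2 / L) < (1 + δs n) * Real.tan (π * p.1 / L))},
        deriv w p.1 * (hlKernel L p.1 p.2 * (w p.2 * Real.cot (π * p.2 / L)))
        ∂((volume.restrict (Ioo a (L / 2))).prod (volume.restrict (Ioo 0 (L / 2))))) ≤
      w a * (∫ y in (0 : ℝ)..L / 2, hlKernel L a y * (w y * Real.cot (π * y / L))) +
        ∫ p, deriv w p.1 * (hlKernel L p.1 p.2 * (w p.2 * Real.cot (π * p.2 / L)))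
          ∂((volume.restrict (Ioo a (L / 2))).prod (volume.restrict (Ioo 0 (L / 2)))) := by
    intro n
    have hBm := measurableSet_band L (1 + δs n)
    have hsplit := integral_add_compl hBm hFi
    have hO := (setIntegral_offband_deriv_eq hL ha (hpos n) hw hodd hper hnn).2
    have hQ := setIntegral_offband_dx_nonpos hL ha (hpos n) hw hnn
    linarith
  have hb : Tendsto (fun n => (w a * (∫ y in (0 : ℝ)..L / 2,
        hlKernel L a y * (w y * Real.cot (π * y / L))) +
      ∫ y in Ioo 0 (L / 2), w y * Real.cot (π * y / L) *
        (w (max a (L / π * Real.arctan (Real.tan (π * y / L) / (1 + δs n)))) *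
            hlKernel L (max a (L / π * Real.arctan (Real.tan (π * y / L) / (1 + δs n)))) y -
          w a * hlKernel L a y -
          w (max a (L / π * Real.arctan ((1 + δs n) * Real.tan (π * y / L)))) *
            hlKernel L (max a (L / π * Real.arctan ((1 + δs n) * Real.tan (π * y / L)))) y)) +
      (∫ p in {p : ℝ × ℝ | (p.1 ∈ Ioo 0 (L / 2) ∧ p.2 ∈ Ioo 0 (L / 2)) ∧
        (Real.tan (π * p.1 / L) < (1 + δs n) * Real.tan (π * p.2 / L) ∧
          Real.tan (π * p.2 / L) < (1 + δs n) * Real.tan (π * p.1 / L))},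
        deriv w p.1 * (hlKernel L p.1 p.2 * (w p.2 * Real.cot (π * p.2 / L)))
        ∂((volume.restrict (Ioo a (L / 2))).prod (volume.restrict (Ioo 0 (L / 2)))))) atTop (𝓝 0) := by
    have h := (tendsto_boundary hL ha hw hodd hper hnn hpos hle1 hlim).add
      (tendsto_band_integral hL ha hw hodd hper hnn hanti hlim)
    rwa [add_zero] at h
  exact le_of_tendsto' hb hmain

/-- **Lemma 7 for `a ∈ (0, ½L)`**: `∫ₐ^{L/2} ω (u cot(μx))_x dx ≥ 0`. Integration by parts in `x`
(`ω(½L) = 0`), Lemma 6 (`u cot(μx) = −(1/π)Φ(x)`), and `boundary_add_integral_nonneg`: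
`∫ₐ^{L/2} ω (u cot)_x = (1/π)[ω(a)Φ(a) + ∫ₐ^{L/2} ω′Φ] ≥ 0`.
[cite: ChoiHouKiselevLuoSverakYao2017, §4 Lemma 7, p. 12] -/
theorem lemma7_of_mem_Ioo {L a : ℝ} (hL : 0 < L) (ha : a ∈ Ioo 0 (L / 2)) {w : ℝ → ℝ}
    (hw : ContDiff ℝ 1 w) (hodd : ∀ y, w (-y) = -w y) (hper : Function.Periodic w L)
    (hnn : ∀ y ∈ Icc 0 (L / 2), 0 ≤ w y) :
    0 ≤ ∫ x in a..L / 2, w x * (deriv (periodicHLVelocity L w) x * Real.cot (π * x / L) -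
      π / L * periodicHLVelocity L w x / Real.sin (π * x / L) ^ 2) := by
  have hL2 : a ≤ L / 2 := ha.2.le
  have hwH := (odd_periodic_zero_half hodd hper).2
  set u : ℝ → ℝ := periodicHLVelocity L w with hu
  have hu1 : ContDiff ℝ 1 u := contDiff_periodicHLVelocity hL 1 hw hper
  have hsin : ∀ x ∈ Icc a (L / 2), Real.sin (π * x / L) ≠ 0 := fun x hx =>
    (sin_phase_pos_of_mem_Ioc hL ⟨ha.1.trans_le hx.1, hx.2⟩).ne'
  have hcot : ContinuousOn (fun x => Real.cot (π * x / L)) (Icc a (L / 2)) := by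
    have h : (fun x => Real.cot (π * x / L)) =
        fun x => Real.cos (π * x / L) / Real.sin (π * x / L) :=
      funext fun x => Real.cot_eq_cos_div_sin _
    rw [h]
    exact ContinuousOn.div (by fun_prop) (by fun_prop) hsin
  have hV : ContinuousOn (fun x => u x * Real.cot (π * x / L)) (Icc a (L / 2)) :=
    hu1.continuous.continuousOn.mul hcot
  have hV' : ContinuousOn (fun x => deriv u x * Real.cot (π * x / L) -
      π / L * u x / Real.sin (π * x / L) ^ 2) (Icc a (L / 2)) := by
    refine ((hu1.continuous_deriv le_rfl).continuousOn.mul hcot).sub ?_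
    exact ContinuousOn.div (continuousOn_const.mul hu1.continuous.continuousOn) (by fun_prop)
      fun x hx => pow_ne_zero 2 (hsin x hx)
  have hparts : ∫ x in a..L / 2, w x * (deriv u x * Real.cot (π * x / L) -
      π / L * u x / Real.sin (π * x / L) ^ 2) =
      w (L / 2) * (u (L / 2) * Real.cot (π * (L / 2) / L)) - w a * (u a * Real.cot (π * a / L)) -
        ∫ x in a..L / 2, deriv w x * (u x * Real.cot (π * x / L)) :=
    intervalIntegral.integral_mul_deriv_eq_deriv_mul_of_hasDeriv_right
      (u := w) (v := fun x => u x * Real.cot (π * x / L)) (u' := deriv w)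
      (v' := fun x => deriv u x * Real.cot (π * x / L) - π / L * u x / Real.sin (π * x / L) ^ 2)
      hw.continuous.continuousOn (by rwa [uIcc_of_le hL2])
      (fun x _ => ((hw.differentiable (by norm_num)).differentiableAt.hasDerivAt).hasDerivWithinAt)
      (fun x hx => by
        rw [min_eq_left hL2, max_eq_right hL2] at hx
        exact (hasDerivAt_periodicHLVelocity_mul_cot hL hw hper
          ⟨ha.1.trans hx.1, hx.2⟩).hasDerivWithinAt)
      ((hw.continuous_deriv le_rfl).intervalIntegrable _ _) (hV'.intervalIntegrable_of_Icc hL2)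
  -- Lemma 6 on `[a, ½L]` (at `x = ½L` both sides vanish)
  have hL6 : ∀ x ∈ Icc a (L / 2), u x * Real.cot (π * x / L) =
      -(1 / π) * ∫ y in (0 : ℝ)..L / 2, hlKernel L x y * (w y * Real.cot (π * y / L)) := by
    intro x hx
    rcases eq_or_lt_of_le hx.2 with h | h
    · rw [h, show π * (L / 2) / L = π / 2 by field_simp, Real.cot_eq_cos_div_sin,
        Real.cos_pi_div_two, zero_div, mul_zero]
      simp [hlKernel_half_left hL]
    · exact periodicHLVelocity_mul_cot hL hw.continuous hodd hper ⟨ha.1.trans_le hx.1, h⟩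
  have hI : ∫ x in a..L / 2, deriv w x * (u x * Real.cot (π * x / L)) =
      -(1 / π) * ∫ x in a..L / 2, deriv w x *
        ∫ y in (0 : ℝ)..L / 2, hlKernel L x y * (w y * Real.cot (π * y / L)) := by
    rw [← intervalIntegral.integral_const_mul]
    refine intervalIntegral.integral_congr fun x hx => ?_
    rw [uIcc_of_le hL2] at hx
    rw [hL6 x hx]
    ring
  have hΨ := boundary_add_integral_nonneg hL ha hw hodd hper hnn
  rw [hparts, hwH, zero_mul, zero_sub, hL6 a ⟨le_rfl, hL2⟩, hI]
  have e : -(w a * (-(1 / π) * ∫ y in (0 : ℝ)..L / 2, hlKernel L a y * (w y * Real.cot (π * y / L)))) -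
      -(1 / π) * (∫ x in a..L / 2, deriv w x *
        ∫ y in (0 : ℝ)..L / 2, hlKernel L x y * (w y * Real.cot (π * y / L))) =
      1 / π * (w a * (∫ y in (0 : ℝ)..L / 2, hlKernel L a y * (w y * Real.cot (π * y / L))) +
        ∫ x in a..L / 2, deriv w x *
          ∫ y in (0 : ℝ)..L / 2, hlKernel L x y * (w y * Real.cot (π * y / L))) := by ring
  rw [e]
  exact mul_nonneg (by positivity) hΨ

/-- **Choi–Hou–Kiselev–Luo–Šverák–Yao 2017, §4 Lemma 7** (p. 12), in the `h7`-shape consumed by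
`not_isGlobalSmooth_of_unique_of_lemma7`: for `L > 0` and every smooth odd `L`-periodic `ω` with
`ω ≥ 0` on `[0, ½L]`, `u = Qω`, and every `a ∈ [0, ½L]`,
`∫ₐ^{L/2} ω(x)·(u_x cot(μx) − μu/sin²(μx)) dx ≥ 0` (`= ∫ₐ^{L/2} ω (u cot(μx))_x dx`). The case
`a ∈ (0,½L)` is `lemma7_of_mem_Ioo`; `a = ½L` is trivial; `a = 0` follows by continuity of
`a ↦ ∫ₐ^{L/2}` (the integrand is integrable on `[0,½L]`, `intervalIntegrable_omega_mul_dV`).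
[cite: ChoiHouKiselevLuoSverakYao2017, §4 Lemma 7, p. 12] -/
theorem lemma7 {L : ℝ} (hL : 0 < L) :
    ∀ w : ℝ → ℝ, ContDiff ℝ (⊤ : ℕ∞) w → (∀ y, w (-y) = -w y) → Function.Periodic w L →
      (∀ y ∈ Icc 0 (L / 2), 0 ≤ w y) → ∀ a ∈ Icc 0 (L / 2),
        0 ≤ ∫ x in a..L / 2, w x * (deriv (periodicHLVelocity L w) x * Real.cot (π * x / L) -
          π / L * periodicHLVelocity L w x / Real.sin (π * x / L) ^ 2) := by
  intro w hw hodd hper hnn a ha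
  have hL2 : (0 : ℝ) ≤ L / 2 := by linarith
  have hw1 : ContDiff ℝ 1 w := by
    have h := (contDiff_infty.1 hw) 1
    simpa using h
  rcases eq_or_lt_of_le ha.2 with hH | haH
  · rw [hH, intervalIntegral.integral_same]
  rcases eq_or_lt_of_le ha.1 with h0 | ha0
  · -- `a = 0`: continuity from the right of `b ↦ ∫_b^{L/2}` at `0`
    rw [← h0]
    obtain ⟨hint, -, -⟩ := intervalIntegrable_omega_mul_dV hL hw1 hodd hper
    rw [intervalIntegrable_iff'] at hint
    have hcont := intervalIntegral.continuousOn_primitive_interval_left hint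
    rw [uIcc_of_le hL2] at hcont
    set F : ℝ → ℝ := fun b => ∫ x in b..L / 2, w x *
      (deriv (periodicHLVelocity L w) x * Real.cot (π * x / L) -
        π / L * periodicHLVelocity L w x / Real.sin (π * x / L) ^ 2) with hF
    have hkey : ∀ b ∈ Ioo 0 (L / 2), 0 ≤ F b := fun b hb =>
      lemma7_of_mem_Ioo hL hb hw1 hodd hper hnn
    show 0 ≤ F 0
    by_contra hneg
    rw [not_le] at hneg
    have hc0 := hcont 0 ⟨le_rfl, hL2⟩
    rw [Metric.continuousWithinAt_iff] at hc0
    obtain ⟨d, hd, hdc⟩ := hc0 (-F 0 / 2) (by linarith)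
    have hLpos : 0 < L / 2 := by rw [← h0] at haH; exact haH
    set b := min (d / 2) (L / 4) with hb
    have hb0 : 0 < b := lt_min (by linarith) (by linarith)
    have hbH : b < L / 2 := (min_le_right _ _).trans_lt (by linarith)
    have hbd : dist b 0 < d := by
      rw [Real.dist_eq, sub_zero, abs_of_pos hb0]
      exact (min_le_left _ _).trans_lt (by linarith)
    have h1 := hdc ⟨hb0.le, hbH.le⟩ hbd
    have h2 := hkey b ⟨hb0, hbH⟩
    rw [Real.dist_eq] at h1
    have h3 := (abs_lt.1 h1).2
    simp only [hF] at h2 h3 hneg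
    linarith
  · exact lemma7_of_mem_Ioo hL ⟨ha0, haH⟩ hw1 hodd hper hnn

end ChoiEtAl2017

end Literature.Analysis.FluidPDE
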